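import Literature.NumberTheory.LFunctions.DirichletPolynomialShortWindows
import Literature.NumberTheory.Sieve.MatomakiRadziwill
import Mathlib.MeasureTheory.Integral.Prod
import Mathlib.MeasureTheory.Function.JacobianOneDim
import Mathlib.Analysis.SpecialFunctions.ImproperIntegrals
import Mathlib.MeasureTheory.Integral.IntegralEqImproper
import Mathlib.Analysis.SpecificLimits.Basic

/-!
# Matomäki–Radziwiłł 2016, Lemma 14 (the Parseval bound): proof

Topic `NumberTheory/Sieve`.  This file **proves** the named fact
`Literature.NumberTheory.Sieve.MatomakiRadziwill2016_lemma14_real` of `MatomakiRadziwill.lean` (Lemma 14 of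
Matomäki–Radziwiłł, Ann. of Math. 183 (2016), §7, for a real sequence `|a_m| ≤ 1`):

* `MatomakiRadziwill2016_lemma14_real_holds : MatomakiRadziwill2016_lemma14_real`

with the absolute constant `C = 12 · 2431²` and `X₀ = e`.  Together with
`MatomakiRadziwillTheorem3.lean` and `MatomakiRadziwillTheorem1.lean` this reduces the named-fact
frontier below `Literature.NumberTheory.Sieve.matomaki_radziwill` (parity.S38) to {Lemma 4, Proposition 1}.

## The argument

The harmonic analysis (window sums in the variable `v = log x`, their Fourier transforms, the smooth
low/high frequency split `W_θ = L_θ + H_θ` at `|t| ≍ T₀ = (log X)^{1/15}`, the estimate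
`L_θ = θΨ + O(τ'²θ²)`, and the Plancherel bound for `H_θ`) is in
`Literature/NumberTheory/LFunctions/DirichletPolynomialShortWindows.lean`; see its docstring for the
comparison with the printed proof (Perron's formula is replaced by Plancherel on `L¹ ∩ L²`, so that
only absolutely convergent integrals occur).  This file does the bookkeeping of §7:

1. *Coefficients.* `b_m = a_m/m` on `[X, 4X]` (`coeffB`, `suppM`), `∑|b_m| ≤ 4`; the statement's
   `A(1+it) = ∑ a_m m^{-1-it}` is `dirichletSum` at `ξ = t/2π` (`sum_cpow_eq_dirichletSum`).
2. *Step A.* For non-integral `y` the short average `h⁻¹∑_{y ≤ m ≤ y+h} a_m` is `(y/h) N(y,h)` up to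
   `(h+1)/X`, `N(y,h) = ∑_{y<m≤y+h} b_m` (`abs_avg_sub_mul_addWindow_le`).
3. *Saffari–Vaughan-type identity* (`addWindow_eq_sub`): for every `θ` with `y e^θ ≥ y + h`,
   `N(y,h) = W_θ(log y) - W_{θ-c(y)}(log(y+h))`, `c(y) = log(1 + h/y)`; the admissible widths are
   `θ ∈ [θ_a, θ_b]`, `θ_a = log(1 + h/X)`, `θ_b = θ_a + h/X` (`thetaA`, `thetaB`).
4. *Low part* (the paper's `U_j`): by linearity of `L_θ` in `θ` the two multiplicative windows leave
   the main term `c(y) Ψ(log y)`, and `(y/h) c(y) = 1 + O(h/X)`, so that the short average is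
   `Ψ(log y) + (y/h)(H_θ(log y) - H_{θ-c}(log(y+h))) + O(K h/X)` with `K = O(τ'²)`
   (`norm_avg_sub_main_sub_high_le`); `Ψ(log y)` **does not depend on `h`** and cancels in `D₁ - D₂`,
   the error being `O(τ'² h₂/X) = O((log X)^{2/15 - 1/5}) = O((log X)^{-1/15})`.
5. *High part* (the paper's `V_j`): square, average over `θ ∈ [θ_a, θ_b]` (`sq_sub_le_Qint`; the
   shifted width `θ - c(y)` stays in `[0, θ_b]`), integrate over `y ∈ (X, 2X]` a.e. (integers are
   null), exchange the integrations (Tonelli) and change variables `y = e^v`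
   (`setIntegral_Qint_log_le`), and apply the Plancherel bound: everything is controlled by
   `P = 2∫_{ξ>τ'} min(θ_b², 1/(π²ξ²)) |A(ξ)|² dξ = π⁻¹ ∫_{t > 2πτ'} min(θ_b², 4/t²)|A(t)|² dt` (`Pbound_eq`).
6. *Frequency side.* `min(θ_b², 4/t²) ≤ θ_b² 1_{t ≤ X/h} + 4t⁻² 1_{t > X/h}` gives
   `I₁ = ∫_{T₀}^{X/h₁}|A|²` and the tail `∫_{X/h₁}^∞ |A|² t⁻² dt ≤ 2 S (h₁/X)²` by a dyadic
   decomposition against the `max` term `S` (`integral_Ioi_le_Ssup`; the paper's last display), so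
   `P ≤ (8/π)(h/X)²(I₁ + S)` (`Pbound_le`).

## References

* K. Matomäki, M. Radziwiłł, *Multiplicative functions in short intervals*, Ann. of Math. (2) 183
  (2016), 1015–1056, doi:10.4007/annals.2016.183.3.6 (arXiv:1501.04585): §7, Lemma 14 and its
  proof (arXiv pp. 15–16).
* B. Saffari, R. C. Vaughan, *On the fractional parts of x/n and related sequences II*, Ann. Inst.
  Fourier 27 (1977) — the averaging device cited as [SaVa77] in the paper (not used verbatim here).
-/

noncomputable section

open MeasureTheory Real Complex Finset Set Filter
open Literature.NumberTheory.LFunctions.WindowPlancherel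

namespace Literature.NumberTheory.Sieve

namespace MatomakiRadziwillL14

/-! ### The coefficients `b_m = a_m / m` and the Dirichlet polynomial -/

/-- The integers of `[X, 4X]`. [folklore] -/
def suppM (X : ℝ) : Finset ℕ := Icc ⌈X⌉₊ ⌊4 * X⌋₊

/-- `b_m = a_m / m`. [folklore] -/
def coeffB (a : ℕ → ℝ) (m : ℕ) : ℝ := a m / m

/-- Members of `[X, 4X]` are `≥ 1` when `X ≥ 1`. [folklore] -/
theorem one_le_of_mem_suppM {X : ℝ} (hX : 1 ≤ X) {m : ℕ} (hm : m ∈ suppM X) : 1 ≤ m := by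
  rw [suppM, Finset.mem_Icc] at hm
  have : 1 ≤ ⌈X⌉₊ := Nat.one_le_iff_ne_zero.2 (by
    intro h; rw [Nat.ceil_eq_zero] at h; linarith)
  exact this.trans hm.1

/-- Members of `[X, 4X]` are `≥ X`. [folklore] -/
theorem X_le_of_mem_suppM {X : ℝ} {m : ℕ} (hm : m ∈ suppM X) : X ≤ m := by
  rw [suppM, Finset.mem_Icc] at hm
  exact (Nat.le_ceil X).trans (by exact_mod_cast hm.1)

/-- Members of `[X, 4X]` are `≤ 4X`. [folklore] -/
theorem le_fourX_of_mem_suppM {X : ℝ} (hX : 0 ≤ X) {m : ℕ} (hm : m ∈ suppM X) : (m : ℝ) ≤ 4 * X := by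
  rw [suppM, Finset.mem_Icc] at hm
  exact (Nat.cast_le.2 hm.2).trans (Nat.floor_le (by linarith))

/-- `|b_m| ≤ 1/X` on `[X, 4X]`. [folklore] -/
theorem abs_coeffB_le {a : ℕ → ℝ} (ha : ∀ m, |a m| ≤ 1) {X : ℝ} (hX : 1 ≤ X) {m : ℕ}
    (hm : m ∈ suppM X) : |coeffB a m| ≤ 1 / X := by
  have hm1 : (1 : ℝ) ≤ m := by exact_mod_cast one_le_of_mem_suppM hX hm
  rw [coeffB, abs_div, Nat.abs_cast]
  calc |a m| / m ≤ 1 / m := div_le_div_of_nonneg_right (ha m) (by linarith)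
    _ ≤ 1 / X := one_div_le_one_div_of_le (by linarith) (X_le_of_mem_suppM hm)

/-- `#[X, 4X] ≤ 3X + 1`. [folklore] -/
theorem card_suppM_le {X : ℝ} (hX : 1 ≤ X) : (#(suppM X) : ℝ) ≤ 3 * X + 1 := by
  rw [suppM, Nat.card_Icc]
  have hc : (⌈X⌉₊ : ℝ) < X + 1 := Nat.ceil_lt_add_one (by linarith)
  have hf : 4 * X < (⌊4 * X⌋₊ : ℝ) + 1 := Nat.lt_floor_add_one _
  have hle : ⌈X⌉₊ ≤ ⌊4 * X⌋₊ + 1 := by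
    have : (⌈X⌉₊ : ℝ) ≤ (⌊4 * X⌋₊ : ℝ) + 1 := by linarith
    exact_mod_cast this
  rw [Nat.cast_sub hle]
  have h2 : (⌊4 * X⌋₊ : ℝ) ≤ 4 * X := Nat.floor_le (by linarith)
  have h3 : X ≤ (⌈X⌉₊ : ℝ) := Nat.le_ceil X
  push_cast; linarith

/-- `β = ∑ |b_m| ≤ 4`. [folklore] -/
theorem sum_abs_coeffB_le {a : ℕ → ℝ} (ha : ∀ m, |a m| ≤ 1) {X : ℝ} (hX : 1 ≤ X) :
    ∑ m ∈ suppM X, |coeffB a m| ≤ 4 := by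
  calc ∑ m ∈ suppM X, |coeffB a m| ≤ ∑ m ∈ suppM X, 1 / X :=
        Finset.sum_le_sum fun m hm => abs_coeffB_le ha hX hm
    _ = #(suppM X) * (1 / X) := by rw [Finset.sum_const, nsmul_eq_mul]
    _ ≤ (3 * X + 1) * (1 / X) := mul_le_mul_of_nonneg_right (card_suppM_le hX) (by positivity)
    _ = 3 + 1 / X := by field_simp
    _ ≤ 4 := by
        have : 1 / X ≤ 1 := by rw [div_le_one (by linarith)]; exact hX
        linarith

/-- `x^{-(1+it)} = x⁻¹ e^{-it log x}` for `x > 0`. [folklore] -/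
theorem ofReal_cpow_neg_one_add (x : ℝ) (hx : 0 < x) (t : ℝ) :
    ((x : ℝ) : ℂ) ^ (-(1 + (t : ℂ) * Complex.I))
      = ((x : ℝ) : ℂ)⁻¹ * Complex.exp (-(↑(t * Real.log x)) * Complex.I) := by
  rw [Complex.cpow_def_of_ne_zero (Complex.ofReal_ne_zero.2 hx.ne'), ← Complex.ofReal_log hx.le,
    show (↑(Real.log x) : ℂ) * -(1 + ↑t * Complex.I)
      = -(↑(Real.log x)) + (-(↑(t * Real.log x)) * Complex.I) by push_cast; ring,
    Complex.exp_add, Complex.exp_neg, ← Complex.ofReal_exp, Real.exp_log hx]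

/-- The Dirichlet polynomial of the statement is `dirichletSum` at `ξ = t/(2π)`:
`∑ a_m m^{-1-it} = ∑ (a_m/m) e(-(t/2π) log m)`. [folklore] -/
theorem sum_cpow_eq_dirichletSum (a : ℕ → ℝ) {X : ℝ} (hX : 1 ≤ X) (t : ℝ) :
    ∑ m ∈ suppM X, (a m : ℂ) * (m : ℂ) ^ (-(1 + (t : ℂ) * Complex.I))
      = dirichletSum (suppM X) (coeffB a) (t / (2 * π)) := by
  unfold dirichletSum
  refine Finset.sum_congr rfl fun m hm => ?_
  have hm0 : (0 : ℝ) < m := by exact_mod_cast one_le_of_mem_suppM hX hm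
  rw [show (m : ℂ) = ((m : ℝ) : ℂ) by simp, ofReal_cpow_neg_one_add _ hm0, coeffB]
  have e : -(↑(t * Real.log m)) * Complex.I = ↑(-2 * π * (t / (2 * π) * Real.log m)) * Complex.I := by
    congr 1
    have : (2 : ℝ) * π ≠ 0 := by positivity
    push_cast
    field_simp
  rw [e]
  push_cast
  field_simp

/-- `|A(t)| ≤ β`. [folklore] -/
theorem norm_sum_cpow_le (a : ℕ → ℝ) {X : ℝ} (hX : 1 ≤ X) (t : ℝ) :
    ‖∑ m ∈ suppM X, (a m : ℂ) * (m : ℂ) ^ (-(1 + (t : ℂ) * Complex.I))‖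
      ≤ ∑ m ∈ suppM X, |coeffB a m| := by
  rw [sum_cpow_eq_dirichletSum a hX]
  exact norm_dirichletSum_le _ _ _

/-! ### Window sums: additive and multiplicative -/

/-- The additive window sum `N(y, h) = ∑_{y < m ≤ y + h} b_m` over `m ∈ [X, 4X]`. [folklore] -/
def addWindow (X : ℝ) (b : ℕ → ℝ) (y h : ℝ) : ℝ :=
  ∑ m ∈ (suppM X).filter (fun m : ℕ => y < m ∧ (m : ℝ) ≤ y + h), b m

/-- The log-scale window at `v = log y` is the multiplicative window `(y, y e^θ]`:
`W_θ(log y) = ∑_{y < m ≤ y e^θ} b_m`. [folklore] -/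
theorem logWindow_log (X : ℝ) (hX : 1 ≤ X) (b : ℕ → ℝ) {y : ℝ} (hy : 0 < y) (θ : ℝ) :
    logWindow (suppM X) b θ (Real.log y)
      = ((∑ m ∈ (suppM X).filter (fun m : ℕ => y < m ∧ (m : ℝ) ≤ y * Real.exp θ), b m : ℝ) : ℂ) := by
  rw [logWindow_apply]
  push_cast
  refine Finset.sum_congr ?_ fun _ _ => rfl
  ext m
  simp only [Finset.mem_filter, and_congr_right_iff]
  intro hm
  have hm0 : (0 : ℝ) < m := by exact_mod_cast one_le_of_mem_suppM hX hm
  rw [Real.log_lt_log_iff hy hm0, sub_le_iff_le_add, ← Real.log_exp θ, ← Real.log_mul hy.ne'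
    (Real.exp_pos θ).ne', Real.log_exp, Real.log_le_log_iff hm0 (mul_pos hy (Real.exp_pos θ))]
  tauto

/-- **The window identity** behind the Saffari–Vaughan averaging: for `z = y e^θ ≥ y + h`,
`∑_{y<m≤y+h} = ∑_{y<m≤z} - ∑_{y+h<m≤z}`, i.e. `N(y,h) = W_θ(log y) - W_{θ-c}(log(y+h))` with
`c = log(y+h) - log y`. [cite: MatomakiRadziwillAnnals2016, §7, proof of Lemma 14] -/
theorem addWindow_eq_sub (X : ℝ) (hX : 1 ≤ X) (b : ℕ → ℝ) {y h θ : ℝ} (hy : 0 < y) (hh : 0 ≤ h)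
    (hθ : y + h ≤ y * Real.exp θ) :
    (addWindow X b y h : ℂ) = logWindow (suppM X) b θ (Real.log y)
      - logWindow (suppM X) b (θ - (Real.log (y + h) - Real.log y)) (Real.log (y + h)) := by
  have hyh : 0 < y + h := by linarith
  rw [logWindow_log X hX b hy, logWindow_log X hX b hyh]
  have hz : (y + h) * Real.exp (θ - (Real.log (y + h) - Real.log y)) = y * Real.exp θ := by
    rw [Real.exp_sub, Real.exp_sub, Real.exp_log hyh, Real.exp_log hy]
    field_simp
  rw [hz, addWindow]
  norm_cast
  rw [eq_sub_iff_add_eq]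
  rw [← Finset.sum_filter_add_sum_filter_not ((suppM X).filter fun m : ℕ => y < m ∧ (m : ℝ) ≤ y * Real.exp θ)
    (fun m : ℕ => (m : ℝ) ≤ y + h)]
  congr 1
  · refine Finset.sum_congr ?_ fun _ _ => rfl
    ext m; simp only [Finset.mem_filter]
    constructor
    · rintro ⟨hm, h1, h2⟩; exact ⟨⟨hm, h1, h2.trans hθ⟩, h2⟩
    · rintro ⟨⟨hm, h1, h2⟩, h3⟩; exact ⟨hm, h1, h3⟩
  · refine Finset.sum_congr ?_ fun _ _ => rfl
    ext m; simp only [Finset.mem_filter, not_le]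
    constructor
    · rintro ⟨hm, h1, h2⟩; exact ⟨⟨hm, by linarith, h2⟩, h1⟩
    · rintro ⟨⟨hm, h1, h2⟩, h3⟩; exact ⟨hm, h3, h2⟩

/-- For non-integral `y ∈ [X, 2X]` and `y + h ≤ 4X` the integers of `[y, y+h]` are the `m ∈ [X,4X]`
with `y < m ≤ y + h`. [folklore] -/
theorem Icc_eq_filter {X y h : ℝ} (hX : 1 ≤ X) (hy : X ≤ y) (hh : 0 ≤ h) (hyh : y + h ≤ 4 * X)
    (hyN : ∀ n : ℕ, (n : ℝ) ≠ y) :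
    Finset.Icc ⌈y⌉₊ ⌊y + h⌋₊ = (suppM X).filter (fun m : ℕ => y < m ∧ (m : ℝ) ≤ y + h) := by
  have hy0 : 0 ≤ y := by linarith
  have hfl : ∀ m : ℕ, m ≤ ⌊y + h⌋₊ ↔ (m : ℝ) ≤ y + h := fun m => Nat.le_floor_iff (by linarith)
  ext m
  simp only [Finset.mem_Icc, Finset.mem_filter, suppM, Nat.ceil_le, hfl]
  constructor
  · rintro ⟨h1, h2⟩
    have h1' : y < m := lt_of_le_of_ne h1 (fun h => hyN m h.symm)
    refine ⟨⟨hy.trans h1, ?_⟩, h1', h2⟩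
    exact Nat.le_floor (h2.trans hyh)
  · rintro ⟨-, h1, h2⟩
    exact ⟨h1.le, h2⟩

/-- The number of integers in `(y, y + h]` is at most `h + 1`. [folklore] -/
theorem card_filter_window_le {X y h : ℝ} (hy : 0 ≤ y) (hh : 0 ≤ h) :
    (#((suppM X).filter (fun m : ℕ => y < m ∧ (m : ℝ) ≤ y + h)) : ℝ) ≤ h + 1 := by
  have hsub : (suppM X).filter (fun m : ℕ => y < m ∧ (m : ℝ) ≤ y + h) ⊆ Finset.Icc ⌈y⌉₊ ⌊y + h⌋₊ := by
    intro m hm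
    rw [Finset.mem_filter] at hm
    rw [Finset.mem_Icc]
    exact ⟨Nat.ceil_le.2 hm.2.1.le, Nat.le_floor hm.2.2⟩
  calc (#((suppM X).filter (fun m : ℕ => y < m ∧ (m : ℝ) ≤ y + h)) : ℝ)
      ≤ #(Finset.Icc ⌈y⌉₊ ⌊y + h⌋₊) := by exact_mod_cast Finset.card_le_card hsub
    _ = ((⌊y + h⌋₊ + 1 - ⌈y⌉₊ : ℕ) : ℝ) := by rw [Nat.card_Icc]
    _ ≤ h + 1 := by
        have h1 : (⌊y + h⌋₊ : ℝ) ≤ y + h := Nat.floor_le (by linarith)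
        have h2 : y ≤ ⌈y⌉₊ := Nat.le_ceil y
        rcases le_or_gt ⌈y⌉₊ (⌊y + h⌋₊ + 1) with h3 | h3
        · rw [Nat.cast_sub h3]; push_cast; linarith
        · rw [Nat.sub_eq_zero_of_le h3.le]; push_cast; linarith

/-- **Step A (weights)**: `|h⁻¹ ∑_{y<m≤y+h} a_m - (y/h) N(y,h)| ≤ (h+1)/X` for `y ≥ X ≥ 1`. [folklore] -/
theorem abs_avg_sub_mul_addWindow_le {a : ℕ → ℝ} (ha : ∀ m, |a m| ≤ 1) {X y h : ℝ} (hX : 1 ≤ X)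
    (hy : X ≤ y) (hh : 0 < h) :
    |h⁻¹ * ∑ m ∈ (suppM X).filter (fun m : ℕ => y < m ∧ (m : ℝ) ≤ y + h), a m
        - y / h * addWindow X (coeffB a) y h| ≤ (h + 1) / X := by
  set T := (suppM X).filter (fun m : ℕ => y < m ∧ (m : ℝ) ≤ y + h) with hT
  have hy0 : 0 < y := by linarith
  have e : h⁻¹ * ∑ m ∈ T, a m - y / h * addWindow X (coeffB a) y h
      = h⁻¹ * ∑ m ∈ T, a m * (1 - y / m) := by
    rw [addWindow, ← hT, Finset.mul_sum, Finset.mul_sum, Finset.mul_sum, ← Finset.sum_sub_distrib]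
    refine Finset.sum_congr rfl fun m hm => ?_
    rw [coeffB]
    have hm0 : (m : ℝ) ≠ 0 := by
      have := one_le_of_mem_suppM hX (Finset.mem_filter.1 hm).1
      positivity
    field_simp
  rw [e, abs_mul, abs_of_pos (inv_pos.2 hh)]
  have hterm : ∀ m ∈ T, |a m * (1 - y / m)| ≤ h / X := by
    intro m hm
    have hm' := Finset.mem_filter.1 hm
    have hmX : X ≤ m := X_le_of_mem_suppM hm'.1
    have hm0 : (0 : ℝ) < m := by linarith
    have h1 : 0 ≤ 1 - y / m := by
      rw [sub_nonneg, div_le_one hm0]; exact hm'.2.1.le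
    have h2 : 1 - y / m ≤ h / X := by
      have : (1 - y / m) = (m - y) / m := by field_simp
      rw [this, div_le_div_iff₀ hm0 (by linarith)]
      nlinarith [hm'.2.2]
    rw [abs_mul, abs_of_nonneg h1]
    calc |a m| * (1 - y / m) ≤ 1 * (h / X) := mul_le_mul (ha m) h2 h1 zero_le_one
      _ = h / X := one_mul _
  calc h⁻¹ * |∑ m ∈ T, a m * (1 - y / m)| ≤ h⁻¹ * ∑ m ∈ T, |a m * (1 - y / m)| :=
        mul_le_mul_of_nonneg_left (Finset.abs_sum_le_sum_abs _ _) (inv_pos.2 hh).le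
    _ ≤ h⁻¹ * (#T * (h / X)) := by
        refine mul_le_mul_of_nonneg_left ?_ (inv_pos.2 hh).le
        have := Finset.sum_le_sum hterm
        rwa [Finset.sum_const, nsmul_eq_mul] at this
    _ ≤ h⁻¹ * ((h + 1) * (h / X)) := by
        refine mul_le_mul_of_nonneg_left ?_ (inv_pos.2 hh).le
        exact mul_le_mul_of_nonneg_right (card_filter_window_le hy0.le hh.le) (by positivity)
    _ = (h + 1) / X := by field_simp


/-! ### The parameters of the averaging and the shift `c(y) = log(1 + h/y)` -/

/-- `θ_a = log(1 + h/X)`: the smallest multiplicative width used (so that `y e^θ ≥ y + h` on `[X,2X]`). [folklore] -/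
def thetaA (X h : ℝ) : ℝ := Real.log (1 + h / X)

/-- `θ_b = θ_a + h/X`: the largest multiplicative width used. [folklore] -/
def thetaB (X h : ℝ) : ℝ := thetaA X h + h / X

/-- `c(y) = log(y + h) - log y`. [folklore] -/
def cShift (y h : ℝ) : ℝ := Real.log (y + h) - Real.log y

/-- `0 ≤ θ_a`. [folklore] -/
theorem thetaA_nonneg {X h : ℝ} (hX : 0 < X) (hh : 0 ≤ h) : 0 ≤ thetaA X h :=
  Real.log_nonneg (by have := div_nonneg hh hX.le; linarith)

/-- `θ_a ≤ h/X` (`log(1+u) ≤ u`). [folklore] -/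
theorem thetaA_le {X h : ℝ} (hX : 0 < X) (hh : 0 ≤ h) : thetaA X h ≤ h / X := by
  unfold thetaA
  have := Real.log_le_sub_one_of_pos (by have := div_nonneg hh hX.le; linarith : (0 : ℝ) < 1 + h / X)
  linarith

/-- `θ_b ≤ 2h/X`. [folklore] -/
theorem thetaB_le {X h : ℝ} (hX : 0 < X) (hh : 0 ≤ h) : thetaB X h ≤ 2 * (h / X) := by
  unfold thetaB; have := thetaA_le hX hh; linarith

/-- `θ_a ≤ θ_b`. [folklore] -/
theorem thetaA_le_thetaB {X h : ℝ} (hX : 0 < X) (hh : 0 ≤ h) : thetaA X h ≤ thetaB X h := by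
  unfold thetaB; have := div_nonneg hh hX.le; linarith

/-- `c(y) = log(1 + h/y)`. [folklore] -/
theorem cShift_eq {y h : ℝ} (hy : 0 < y) (hh : 0 ≤ h) : cShift y h = Real.log (1 + h / y) := by
  unfold cShift
  rw [← Real.log_div (by linarith) hy.ne']
  congr 1; field_simp

/-- `0 ≤ c(y)`. [folklore] -/
theorem cShift_nonneg {y h : ℝ} (hy : 0 < y) (hh : 0 ≤ h) : 0 ≤ cShift y h := by
  rw [cShift_eq hy hh]; exact Real.log_nonneg (by have := div_nonneg hh hy.le; linarith)

/-- `c(y) ≤ h/y`. [folklore] -/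
theorem cShift_le {y h : ℝ} (hy : 0 < y) (hh : 0 ≤ h) : cShift y h ≤ h / y := by
  rw [cShift_eq hy hh]
  have := Real.log_le_sub_one_of_pos (by have := div_nonneg hh hy.le; linarith : (0 : ℝ) < 1 + h / y)
  linarith

/-- `c(y) ≤ θ_a` on `y ≥ X`. [folklore] -/
theorem cShift_le_thetaA {X y h : ℝ} (hX : 0 < X) (hy : X ≤ y) (hh : 0 ≤ h) : cShift y h ≤ thetaA X h := by
  have hy0 : 0 < y := by linarith
  rw [cShift_eq hy0 hh, thetaA]
  refine Real.log_le_log (by have := div_nonneg hh hy0.le; linarith) ?_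
  have := div_le_div_of_nonneg_left hh hX hy
  linarith

/-- `c(y) ≥ h/(y+h)` (from `log x ≥ 1 - 1/x`). [folklore] -/
theorem div_le_cShift {y h : ℝ} (hy : 0 < y) (hh : 0 ≤ h) : h / (y + h) ≤ cShift y h := by
  rw [cShift_eq hy hh]
  have := Real.one_sub_inv_le_log_of_pos (by have := div_nonneg hh hy.le; linarith : (0 : ℝ) < 1 + h / y)
  refine le_trans (le_of_eq ?_) this
  field_simp
  ring

/-- **Main-term comparison**: `|y c(y)/h - 1| ≤ h/y`. [folklore] -/
theorem abs_mul_cShift_div_sub_one_le {y h : ℝ} (hy : 0 < y) (hh : 0 < h) :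
    |y * cShift y h / h - 1| ≤ h / y := by
  have h1 := cShift_le hy hh.le
  have h2 := div_le_cShift hy hh.le
  rw [abs_le]
  constructor
  · -- lower: y c/h ≥ y/(y+h) = 1 - h/(y+h) ≥ 1 - h/y
    have h3 : y * (h / (y + h)) / h ≤ y * cShift y h / h := by gcongr
    have h4 : y * (h / (y + h)) / h = 1 - h / (y + h) := by field_simp; ring
    have h5 : h / (y + h) ≤ h / y := div_le_div_of_nonneg_left hh.le hy (by linarith)
    linarith
  · have h3 : y * cShift y h / h ≤ y * (h / y) / h := by gcongr
    have h4 : y * (h / y) / h = 1 := by field_simp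
    have : 0 ≤ h / y := by positivity
    linarith

/-- On `[X, 2X]`, a width `θ ≥ θ_a` reaches beyond `y + h`: `y + h ≤ y e^θ`. [folklore] -/
theorem add_le_mul_exp {X y h θ : ℝ} (hX : 0 < X) (hy : X ≤ y) (hh : 0 ≤ h) (hθ : thetaA X h ≤ θ) :
    y + h ≤ y * Real.exp θ := by
  have hy0 : 0 < y := by linarith
  have h1 : 1 + h / X ≤ Real.exp θ := by
    have := Real.exp_le_exp.2 hθ
    rwa [thetaA, Real.exp_log (by have := div_nonneg hh hX.le; linarith)] at this
  have h2 : h ≤ y * (h / X) := by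
    rw [mul_div_assoc']
    rw [le_div_iff₀ hX]
    nlinarith
  nlinarith

/-! ### The low-frequency (U) part: pointwise cancellation -/

/-- **U-part estimate.**  For `θ ∈ [θ_a, θ_b]`, with `v = log y`, `v' = log(y+h)`, `c = c(y)`:
`‖N(y,h) - c Ψ(v) - (H_θ(v) - H_{θ-c}(v'))‖ ≤ 16π τ'² (θ c + θ²) ∑|b_m|` — the low parts of the two
multiplicative windows representing the additive window cancel up to the main term `c Ψ(v)`, which is
linear in the window length. [cite: MatomakiRadziwillAnnals2016, §7, proof of Lemma 14 (the `U_j` part)] -/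
theorem norm_addWindow_sub_main_sub_high_le (X : ℝ) (hX : 1 ≤ X) (b : ℕ → ℝ) (τ : ℝ) {y h θ : ℝ}
    (hy : X ≤ y) (hh : 0 ≤ h) (hθ : thetaA X h ≤ θ) :
    ‖(addWindow X b y h : ℂ) - (cShift y h : ℂ) * lowPassMain (suppM X) b τ (Real.log y)
        - (highPart (suppM X) b τ θ (Real.log y)
            - highPart (suppM X) b τ (θ - cShift y h) (Real.log (y + h)))‖
      ≤ 16 * π * cutoffRadius τ ^ 2 * (θ * cShift y h + θ ^ 2) * ∑ m ∈ suppM X, |b m| := by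
  have hX0 : 0 < X := by linarith
  have hy0 : 0 < y := by linarith
  set c := cShift y h with hc
  set v := Real.log y
  set v' := Real.log (y + h)
  set s := suppM X
  set β := ∑ m ∈ suppM X, |b m|
  have hc0 : 0 ≤ c := cShift_nonneg hy0 hh
  have hcθ : c ≤ θ := (cShift_le_thetaA hX0 hy hh).trans hθ
  have hθ0 : 0 ≤ θ := hc0.trans hcθ
  have hθc0 : 0 ≤ θ - c := by linarith
  have hvv' : v' - v = c := rfl
  -- the window identity and `W = L + H`
  have hN : (addWindow X b y h : ℂ) = logWindow s b θ v - logWindow s b (θ - c) v' :=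
    addWindow_eq_sub X hX b hy0 hh (add_le_mul_exp hX0 hy hh hθ)
  have hW : ∀ θ' u, logWindow s b θ' u = lowPart s b τ θ' u + highPart s b τ θ' u := by
    intro θ' u; simp [highPart]
  rw [hW, hW] at hN
  -- the three error pieces
  have e1 := norm_lowPart_sub_le s b τ hθ0 v
  have e2 := norm_lowPart_sub_le s b τ hθc0 v'
  have e3 := norm_lowPassMain_sub_le s b τ v v'
  have key : (addWindow X b y h : ℂ) - (c : ℂ) * lowPassMain s b τ v
      - (highPart s b τ θ v - highPart s b τ (θ - c) v')
      = (lowPart s b τ θ v - θ * lowPassMain s b τ v)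
        - (lowPart s b τ (θ - c) v' - ↑(θ - c) * lowPassMain s b τ v')
        + ↑(θ - c) * (lowPassMain s b τ v - lowPassMain s b τ v') := by
    rw [hN]; push_cast; ring
  rw [key]
  refine (norm_add_le _ _).trans ?_
  refine (add_le_add (norm_sub_le _ _) le_rfl).trans ?_
  rw [norm_mul, Complex.norm_real, Real.norm_eq_abs, abs_of_nonneg hθc0]
  have hvabs : |v - v'| = c := by rw [abs_sub_comm, hvv', abs_of_nonneg hc0]
  rw [hvabs] at e3
  have hβ : 0 ≤ β := Finset.sum_nonneg fun _ _ => abs_nonneg _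
  have hr := cutoffRadius_pos τ
  have f1 : 8 * π * cutoffRadius τ ^ 2 * (θ - c) ^ 2 * β ≤ 8 * π * cutoffRadius τ ^ 2 * θ ^ 2 * β := by
    gcongr; linarith
  have f2 : (θ - c) * (16 * π * cutoffRadius τ ^ 2 * c * β) ≤ θ * (16 * π * cutoffRadius τ ^ 2 * c * β) := by
    apply mul_le_mul_of_nonneg_right (by linarith) (by positivity)
  calc ‖lowPart s b τ θ v - ↑θ * lowPassMain s b τ v‖
        + ‖lowPart s b τ (θ - c) v' - ↑(θ - c) * lowPassMain s b τ v'‖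
        + (θ - c) * ‖lowPassMain s b τ v - lowPassMain s b τ v'‖
      ≤ 8 * π * cutoffRadius τ ^ 2 * θ ^ 2 * β + 8 * π * cutoffRadius τ ^ 2 * θ ^ 2 * β
        + θ * (16 * π * cutoffRadius τ ^ 2 * c * β) := by
        refine add_le_add (add_le_add e1 (e2.trans f1)) ?_
        exact (mul_le_mul_of_nonneg_left e3 hθc0).trans f2
    _ = 16 * π * cutoffRadius τ ^ 2 * (θ * c + θ ^ 2) * β := by ring


/-! ### Pointwise comparison of one short average with the high part -/

/-- The constant `K(τ') = 2 + 768π τ'² + 16 τ'` of the pointwise comparison. [folklore] -/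
def Kconst (τ : ℝ) : ℝ := 2 + 768 * π * cutoffRadius τ ^ 2 + 16 * cutoffRadius τ

/-- `0 < K`. [folklore] -/
theorem Kconst_pos (τ : ℝ) : 0 < Kconst τ := by
  unfold Kconst; have := cutoffRadius_pos τ; positivity

/-- `K ≤ 2431 τ'²` (as `τ' ≥ 1`, `π ≤ 3.1416`). [folklore] -/
theorem Kconst_le (τ : ℝ) : Kconst τ ≤ 2431 * cutoffRadius τ ^ 2 := by
  unfold Kconst
  have h1 := one_le_cutoffRadius τ
  have hπ : π ≤ 3.1416 := Real.pi_lt_d4.le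
  nlinarith [sq_nonneg (cutoffRadius τ), mul_le_mul_of_nonneg_right hπ (sq_nonneg (cutoffRadius τ))]

/-- **One window, pointwise.**  For non-integral `y ∈ [X, 2X]`, `1 ≤ h ≤ 2X`, `θ ∈ [θ_a, θ_b]`:
`h⁻¹ ∑_{y ≤ m ≤ y+h} a_m = Ψ(log y) + (y/h)(H_θ(log y) - H_{θ-c(y)}(log(y+h))) + O(K h/X)`. The main
term `Ψ(log y)` does not depend on `h`. [cite: MatomakiRadziwillAnnals2016, §7, proof of Lemma 14] -/
theorem norm_avg_sub_main_sub_high_le {a : ℕ → ℝ} (ha : ∀ m, |a m| ≤ 1) {X : ℝ} (hX : 1 ≤ X) (τ : ℝ)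
    {y h θ : ℝ} (hy : X ≤ y) (hy2 : y ≤ 2 * X) (hh : 1 ≤ h) (hh2 : h ≤ 2 * X)
    (hyN : ∀ n : ℕ, (n : ℝ) ≠ y) (hθ : thetaA X h ≤ θ) (hθ' : θ ≤ thetaB X h) :
    ‖((h⁻¹ * ∑ m ∈ Finset.Icc ⌈y⌉₊ ⌊y + h⌋₊, a m : ℝ) : ℂ)
        - lowPassMain (suppM X) (coeffB a) τ (Real.log y)
        - ((y / h : ℝ) : ℂ) * (highPart (suppM X) (coeffB a) τ θ (Real.log y)
            - highPart (suppM X) (coeffB a) τ (θ - cShift y h) (Real.log (y + h)))‖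
      ≤ Kconst τ * (h / X) := by
  have hX0 : 0 < X := by linarith
  have hy0 : 0 < y := by linarith
  have hh0 : 0 < h := by linarith
  set s := suppM X
  set b := coeffB a
  set β := ∑ m ∈ s, |b m| with hβdef
  set c := cShift y h
  set v := Real.log y
  set v' := Real.log (y + h)
  set N := addWindow X b y h
  set Ps := lowPassMain s b τ v
  set ΔH := highPart s b τ θ v - highPart s b τ (θ - c) v'
  have hβ4 : β ≤ 4 := sum_abs_coeffB_le ha hX
  have hβ0 : 0 ≤ β := Finset.sum_nonneg fun _ _ => abs_nonneg _
  have hr := cutoffRadius_pos τ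
  have hr1 := one_le_cutoffRadius τ
  -- Step A
  have hD : h⁻¹ * ∑ m ∈ Finset.Icc ⌈y⌉₊ ⌊y + h⌋₊, a m
      = h⁻¹ * ∑ m ∈ s.filter (fun m : ℕ => y < m ∧ (m : ℝ) ≤ y + h), a m := by
    rw [Icc_eq_filter hX hy hh0.le (by linarith) hyN]
  have eA : |h⁻¹ * ∑ m ∈ Finset.Icc ⌈y⌉₊ ⌊y + h⌋₊, a m - y / h * N| ≤ 2 * (h / X) := by
    rw [hD]
    refine (abs_avg_sub_mul_addWindow_le ha hX hy hh0).trans ?_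
    rw [div_le_iff₀ hX0]; field_simp; linarith
  -- U part
  have hc0 : 0 ≤ c := cShift_nonneg hy0 hh0.le
  have hcle : c ≤ h / X := (cShift_le hy0 hh0.le).trans (div_le_div_of_nonneg_left hh0.le hX0 hy)
  have hθb : θ ≤ 2 * (h / X) := hθ'.trans (thetaB_le hX0 hh0.le)
  have hθ0 : 0 ≤ θ := (thetaA_nonneg hX0 hh0.le).trans hθ
  have eU0 := norm_addWindow_sub_main_sub_high_le X hX b τ hy hh0.le hθ
  have eU : ‖((y / h : ℝ) : ℂ) * ((N : ℂ) - (c : ℂ) * Ps - ΔH)‖ ≤ 768 * π * cutoffRadius τ ^ 2 * (h / X) := by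
    rw [norm_mul, Complex.norm_real, Real.norm_eq_abs, abs_of_pos (by positivity)]
    have h6 : θ * c + θ ^ 2 ≤ 6 * (h / X) ^ 2 := by nlinarith
    calc y / h * ‖(N : ℂ) - (c : ℂ) * Ps - ΔH‖
        ≤ (2 * X / h) * (16 * π * cutoffRadius τ ^ 2 * (6 * (h / X) ^ 2) * 4) := by
          refine mul_le_mul (by gcongr) (eU0.trans ?_) (norm_nonneg _) (by positivity)
          gcongr
      _ = 768 * π * cutoffRadius τ ^ 2 * (h / X) := by field_simp; norm_num
  -- main term
  have eM : ‖((y / h : ℝ) : ℂ) * ((c : ℂ) * Ps) - Ps‖ ≤ 16 * cutoffRadius τ * (h / X) := by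
    have : ((y / h : ℝ) : ℂ) * ((c : ℂ) * Ps) - Ps = ((y * c / h - 1 : ℝ) : ℂ) * Ps := by
      push_cast; ring
    rw [this, norm_mul, Complex.norm_real, Real.norm_eq_abs]
    have h1 := abs_mul_cShift_div_sub_one_le hy0 hh0
    have h2 := norm_lowPassMain_le s b τ v
    have h3 : h / y ≤ h / X := div_le_div_of_nonneg_left hh0.le hX0 hy
    calc |y * c / h - 1| * ‖Ps‖ ≤ (h / X) * (4 * cutoffRadius τ * 4) := by
          refine mul_le_mul (h1.trans h3) (h2.trans ?_) (norm_nonneg _) (by positivity)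
          gcongr
      _ = 16 * cutoffRadius τ * (h / X) := by ring
  -- combine
  have key : ((h⁻¹ * ∑ m ∈ Finset.Icc ⌈y⌉₊ ⌊y + h⌋₊, a m : ℝ) : ℂ) - Ps - ((y / h : ℝ) : ℂ) * ΔH
      = (((h⁻¹ * ∑ m ∈ Finset.Icc ⌈y⌉₊ ⌊y + h⌋₊, a m - y / h * N : ℝ)) : ℂ)
        + ((y / h : ℝ) : ℂ) * ((N : ℂ) - (c : ℂ) * Ps - ΔH)
        + (((y / h : ℝ) : ℂ) * ((c : ℂ) * Ps) - Ps) := by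
    push_cast; ring
  rw [key]
  refine (norm_add₃_le).trans ?_
  rw [Complex.norm_real, Real.norm_eq_abs]
  calc |h⁻¹ * ∑ m ∈ Finset.Icc ⌈y⌉₊ ⌊y + h⌋₊, a m - y / h * N|
        + ‖((y / h : ℝ) : ℂ) * ((N : ℂ) - (c : ℂ) * Ps - ΔH)‖ + ‖((y / h : ℝ) : ℂ) * ((c : ℂ) * Ps) - Ps‖
      ≤ 2 * (h / X) + 768 * π * cutoffRadius τ ^ 2 * (h / X) + 16 * cutoffRadius τ * (h / X) :=
        add_le_add (add_le_add eA eU) eM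
    _ = Kconst τ * (h / X) := by unfold Kconst; ring

/-- `(p + q + r)² ≤ 3(p² + q² + r²)`. [folklore] -/
theorem sq_add_three_le (p q r : ℝ) : (p + q + r) ^ 2 ≤ 3 * (p ^ 2 + q ^ 2 + r ^ 2) := by
  nlinarith [sq_nonneg (p - q), sq_nonneg (q - r), sq_nonneg (p - r)]

/-- **Two windows, pointwise.**  For non-integral `y ∈ [X,2X]`, `1 ≤ h₁ ≤ h₂ ≤ 2X` and any
`θ_j ∈ [θ_a(h_j), θ_b(h_j)]`, the main terms cancel and
`(D₁ - D₂)² ≤ 3 (K (h₁+h₂)/X)² + ∑_j 6 (y/h_j)² (‖H_{θ_j}(log y)‖² + ‖H_{θ_j - c_j(y)}(log(y+h_j))‖²)`.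
[cite: MatomakiRadziwillAnnals2016, §7, proof of Lemma 14] -/
theorem sq_sub_le_pointwise {a : ℕ → ℝ} (ha : ∀ m, |a m| ≤ 1) {X : ℝ} (hX : 1 ≤ X) (τ : ℝ)
    {y h₁ h₂ θ₁ θ₂ : ℝ} (hy : X ≤ y) (hy2 : y ≤ 2 * X) (hh₁ : 1 ≤ h₁) (hh₁2 : h₁ ≤ 2 * X)
    (hh₂ : 1 ≤ h₂) (hh₂2 : h₂ ≤ 2 * X) (hyN : ∀ n : ℕ, (n : ℝ) ≠ y)
    (hθ₁ : thetaA X h₁ ≤ θ₁) (hθ₁' : θ₁ ≤ thetaB X h₁) (hθ₂ : thetaA X h₂ ≤ θ₂) (hθ₂' : θ₂ ≤ thetaB X h₂) :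
    (h₁⁻¹ * ∑ m ∈ Finset.Icc ⌈y⌉₊ ⌊y + h₁⌋₊, a m - h₂⁻¹ * ∑ m ∈ Finset.Icc ⌈y⌉₊ ⌊y + h₂⌋₊, a m) ^ 2
      ≤ 3 * (Kconst τ * ((h₁ + h₂) / X)) ^ 2
        + 6 * (y / h₁) ^ 2 * (‖highPart (suppM X) (coeffB a) τ θ₁ (Real.log y)‖ ^ 2
            + ‖highPart (suppM X) (coeffB a) τ (θ₁ - cShift y h₁) (Real.log (y + h₁))‖ ^ 2)
        + 6 * (y / h₂) ^ 2 * (‖highPart (suppM X) (coeffB a) τ θ₂ (Real.log y)‖ ^ 2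
            + ‖highPart (suppM X) (coeffB a) τ (θ₂ - cShift y h₂) (Real.log (y + h₂))‖ ^ 2) := by
  have hX0 : 0 < X := by linarith
  have hy0 : 0 < y := by linarith
  set s := suppM X
  set b := coeffB a
  set D₁ := h₁⁻¹ * ∑ m ∈ Finset.Icc ⌈y⌉₊ ⌊y + h₁⌋₊, a m
  set D₂ := h₂⁻¹ * ∑ m ∈ Finset.Icc ⌈y⌉₊ ⌊y + h₂⌋₊, a m
  set Ps := lowPassMain s b τ (Real.log y)
  set Δ₁ := highPart s b τ θ₁ (Real.log y) - highPart s b τ (θ₁ - cShift y h₁) (Real.log (y + h₁))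
  set Δ₂ := highPart s b τ θ₂ (Real.log y) - highPart s b τ (θ₂ - cShift y h₂) (Real.log (y + h₂))
  have e1 := norm_avg_sub_main_sub_high_le ha hX τ hy hy2 hh₁ hh₁2 hyN hθ₁ hθ₁'
  have e2 := norm_avg_sub_main_sub_high_le ha hX τ hy hy2 hh₂ hh₂2 hyN hθ₂ hθ₂'
  change ‖(D₁ : ℂ) - Ps - ((y / h₁ : ℝ) : ℂ) * Δ₁‖ ≤ Kconst τ * (h₁ / X) at e1
  change ‖(D₂ : ℂ) - Ps - ((y / h₂ : ℝ) : ℂ) * Δ₂‖ ≤ Kconst τ * (h₂ / X) at e2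
  have hdiff : ((D₁ - D₂ : ℝ) : ℂ) = ((D₁ : ℂ) - Ps - ((y / h₁ : ℝ) : ℂ) * Δ₁)
      - ((D₂ : ℂ) - Ps - ((y / h₂ : ℝ) : ℂ) * Δ₂)
      + ((y / h₁ : ℝ) : ℂ) * Δ₁ - ((y / h₂ : ℝ) : ℂ) * Δ₂ := by push_cast; ring
  have hnorm : |D₁ - D₂| ≤ Kconst τ * ((h₁ + h₂) / X) + y / h₁ * ‖Δ₁‖ + y / h₂ * ‖Δ₂‖ := by
    rw [← Real.norm_eq_abs, ← Complex.norm_real, hdiff]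
    refine (norm_sub_le _ _).trans ?_
    refine (add_le_add (norm_add_le _ _) le_rfl).trans ?_
    refine (add_le_add (add_le_add (norm_sub_le _ _) le_rfl) le_rfl).trans ?_
    rw [norm_mul, norm_mul, Complex.norm_real, Complex.norm_real, Real.norm_eq_abs, Real.norm_eq_abs,
      abs_of_pos (by positivity : 0 < y / h₁), abs_of_pos (by positivity : 0 < y / h₂)]
    have : Kconst τ * (h₁ / X) + Kconst τ * (h₂ / X) = Kconst τ * ((h₁ + h₂) / X) := by ring
    linarith
  have hsq : (D₁ - D₂) ^ 2 ≤ (Kconst τ * ((h₁ + h₂) / X) + y / h₁ * ‖Δ₁‖ + y / h₂ * ‖Δ₂‖) ^ 2 := by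
    rw [← sq_abs (D₁ - D₂)]
    exact pow_le_pow_left₀ (abs_nonneg _) hnorm 2
  have hΔ : ∀ (P Q : ℂ), ‖P - Q‖ ^ 2 ≤ 2 * (‖P‖ ^ 2 + ‖Q‖ ^ 2) := by
    intro P Q
    have := norm_sub_le P Q
    nlinarith [norm_nonneg (P - Q), norm_nonneg P, norm_nonneg Q, sq_nonneg (‖P‖ - ‖Q‖)]
  have hΔ₁ := hΔ (highPart s b τ θ₁ (Real.log y)) (highPart s b τ (θ₁ - cShift y h₁) (Real.log (y + h₁)))
  have hΔ₂ := hΔ (highPart s b τ θ₂ (Real.log y)) (highPart s b τ (θ₂ - cShift y h₂) (Real.log (y + h₂)))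
  change ‖Δ₁‖ ^ 2 ≤ _ at hΔ₁
  change ‖Δ₂‖ ^ 2 ≤ _ at hΔ₂
  refine hsq.trans ((sq_add_three_le _ _ _).trans ?_)
  rw [mul_pow, mul_pow]
  have hy1 : 0 ≤ (y / h₁) ^ 2 := sq_nonneg _
  have hy2' : 0 ≤ (y / h₂) ^ 2 := sq_nonneg _
  nlinarith [mul_le_mul_of_nonneg_left hΔ₁ hy1, mul_le_mul_of_nonneg_left hΔ₂ hy2']


/-! ### Averaging over the multiplicative width `θ` -/

/-- `Q(u) = ∫_0^{θ_b} ‖H_θ(u)‖² dθ`: the high-frequency energy at `u` averaged over the widths. [folklore] -/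
def Qint (X : ℝ) (a : ℕ → ℝ) (τ h u : ℝ) : ℝ :=
  ∫ θ in (0 : ℝ)..thetaB X h, ‖highPart (suppM X) (coeffB a) τ θ u‖ ^ 2

/-- `θ ↦ ‖H_θ(u)‖²` is integrable on `[0, Θ]` (bounded and measurable). [folklore] -/
theorem integrableOn_norm_sq_highPart (s : Finset ℕ) (b : ℕ → ℝ) (τ u : ℝ) (Θ : ℝ) :
    IntegrableOn (fun θ => ‖highPart s b τ θ u‖ ^ 2) (Set.Icc 0 Θ) := by
  have hmeas : Measurable fun θ => ‖highPart s b τ θ u‖ ^ 2 := by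
    have h := (measurable_uncurry_highPart s b τ).comp
      (measurable_id.prodMk (measurable_const (a := u)) : Measurable fun θ : ℝ => (θ, u))
    exact h.norm.pow_const 2
  refine Measure.integrableOn_of_bounded (M := ((1 + 4 * cutoffRadius τ * Θ) * ∑ m ∈ s, |b m|) ^ 2)
    (by rw [Real.volume_Icc]; exact ENNReal.ofReal_lt_top.ne) hmeas.aestronglyMeasurable ?_
  refine (ae_restrict_iff' measurableSet_Icc).2 (Eventually.of_forall fun θ hθ => ?_)
  rw [Real.norm_eq_abs, abs_of_nonneg (sq_nonneg _)]
  exact pow_le_pow_left₀ (norm_nonneg _) (norm_highPart_le s b τ hθ.1 hθ.2 u) 2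

/-- `θ ↦ ‖H_θ(u)‖²` is interval integrable on subintervals of `[0, Θ]`. [folklore] -/
theorem intervalIntegrable_norm_sq_highPart (s : Finset ℕ) (b : ℕ → ℝ) (τ u : ℝ) {α β Θ : ℝ}
    (hα : 0 ≤ α) (hαβ : α ≤ β) (hβ : β ≤ Θ) :
    IntervalIntegrable (fun θ => ‖highPart s b τ θ u‖ ^ 2) volume α β := by
  rw [intervalIntegrable_iff_integrableOn_Icc_of_le hαβ]
  exact (integrableOn_norm_sq_highPart s b τ u Θ).mono_set
    (Set.Icc_subset_Icc hα hβ)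

/-- `0 ≤ Q`. [folklore] -/
theorem Qint_nonneg (X : ℝ) (a : ℕ → ℝ) (τ : ℝ) {h : ℝ} (u : ℝ) (hX : 0 < X) (hh : 0 ≤ h) :
    0 ≤ Qint X a τ h u :=
  intervalIntegral.integral_nonneg ((thetaA_nonneg hX hh).trans (thetaA_le_thetaB hX hh))
    fun _ _ => sq_nonneg _

/-- Averaging a pointwise lower bound: `K₀ ≤ f` on `[α, β]` gives `K₀ ≤ (β-α)⁻¹ ∫_α^β f`. [folklore] -/
theorem le_inv_mul_integral_of_forall_le {f : ℝ → ℝ} {α β K₀ : ℝ} (hαβ : α < β)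
    (hf : IntervalIntegrable f volume α β) (h : ∀ θ ∈ Set.Icc α β, K₀ ≤ f θ) :
    K₀ ≤ (β - α)⁻¹ * ∫ θ in α..β, f θ := by
  have h1 : ∫ θ in α..β, K₀ ≤ ∫ θ in α..β, f θ :=
    intervalIntegral.integral_mono_on hαβ.le intervalIntegrable_const hf h
  rw [intervalIntegral.integral_const, smul_eq_mul] at h1
  rw [le_inv_mul_iff₀ (by linarith)]
  linarith

/-- The shifted width integral is dominated by `Q`: `∫_{θ_a}^{θ_b} ‖H_{θ-c}(u)‖² ≤ Q(u)` for
`0 ≤ c ≤ θ_a`. [folklore] -/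
theorem integral_shift_le_Qint (X : ℝ) (a : ℕ → ℝ) (τ : ℝ) {h c : ℝ} (u : ℝ) (hX : 0 < X)
    (hh : 0 ≤ h) (hc0 : 0 ≤ c) (hc : c ≤ thetaA X h) :
    ∫ θ in thetaA X h..thetaB X h, ‖highPart (suppM X) (coeffB a) τ (θ - c) u‖ ^ 2
      ≤ Qint X a τ h u := by
  rw [intervalIntegral.integral_comp_sub_right (fun θ => ‖highPart (suppM X) (coeffB a) τ θ u‖ ^ 2) c,
    Qint]
  have hab := thetaA_le_thetaB hX hh
  refine intervalIntegral.integral_mono_interval (by linarith) (by linarith) (by linarith)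
    (Eventually.of_forall fun θ => sq_nonneg _) ?_
  exact intervalIntegrable_norm_sq_highPart _ _ τ u le_rfl ((thetaA_nonneg hX hh).trans hab) le_rfl

/-- `∫_{θ_a}^{θ_b} ‖H_θ(u)‖² ≤ Q(u)`. [folklore] -/
theorem integral_le_Qint (X : ℝ) (a : ℕ → ℝ) (τ : ℝ) {h : ℝ} (u : ℝ) (hX : 0 < X) (hh : 0 ≤ h) :
    ∫ θ in thetaA X h..thetaB X h, ‖highPart (suppM X) (coeffB a) τ θ u‖ ^ 2 ≤ Qint X a τ h u := by
  have := integral_shift_le_Qint X a τ u hX hh le_rfl (thetaA_nonneg hX hh)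
  simpa using this

/-- **Two windows, pointwise, after averaging over the widths**:
`(D₁ - D₂)² ≤ 3 (K(h₁+h₂)/X)² + ∑_j (24 X³/h_j³) (Q_j(log y) + Q_j(log(y + h_j)))`.
[cite: MatomakiRadziwillAnnals2016, §7, proof of Lemma 14] -/
theorem sq_sub_le_Qint {a : ℕ → ℝ} (ha : ∀ m, |a m| ≤ 1) {X : ℝ} (hX : 1 ≤ X) (τ : ℝ)
    {y h₁ h₂ : ℝ} (hy : X ≤ y) (hy2 : y ≤ 2 * X) (hh₁ : 1 ≤ h₁) (hh₁2 : h₁ ≤ 2 * X)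
    (hh₂ : 1 ≤ h₂) (hh₂2 : h₂ ≤ 2 * X) (hyN : ∀ n : ℕ, (n : ℝ) ≠ y) :
    (h₁⁻¹ * ∑ m ∈ Finset.Icc ⌈y⌉₊ ⌊y + h₁⌋₊, a m - h₂⁻¹ * ∑ m ∈ Finset.Icc ⌈y⌉₊ ⌊y + h₂⌋₊, a m) ^ 2
      ≤ 3 * (Kconst τ * ((h₁ + h₂) / X)) ^ 2
        + 24 * X ^ 3 / h₁ ^ 3 * (Qint X a τ h₁ (Real.log y) + Qint X a τ h₁ (Real.log (y + h₁)))
        + 24 * X ^ 3 / h₂ ^ 3 * (Qint X a τ h₂ (Real.log y) + Qint X a τ h₂ (Real.log (y + h₂))) := by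
  have hX0 : 0 < X := by linarith
  have hy0 : 0 < y := by linarith
  set s := suppM X
  set b := coeffB a
  set LHS := (h₁⁻¹ * ∑ m ∈ Finset.Icc ⌈y⌉₊ ⌊y + h₁⌋₊, a m
    - h₂⁻¹ * ∑ m ∈ Finset.Icc ⌈y⌉₊ ⌊y + h₂⌋₊, a m) ^ 2
  set A := 3 * (Kconst τ * ((h₁ + h₂) / X)) ^ 2
  -- the two width-dependent error functions
  set g₁ : ℝ → ℝ := fun θ => 6 * (y / h₁) ^ 2 * (‖highPart s b τ θ (Real.log y)‖ ^ 2
      + ‖highPart s b τ (θ - cShift y h₁) (Real.log (y + h₁))‖ ^ 2) with hg₁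
  set g₂ : ℝ → ℝ := fun θ => 6 * (y / h₂) ^ 2 * (‖highPart s b τ θ (Real.log y)‖ ^ 2
      + ‖highPart s b τ (θ - cShift y h₂) (Real.log (y + h₂))‖ ^ 2) with hg₂
  have hpt : ∀ θ₁ ∈ Set.Icc (thetaA X h₁) (thetaB X h₁), ∀ θ₂ ∈ Set.Icc (thetaA X h₂) (thetaB X h₂),
      LHS ≤ A + g₁ θ₁ + g₂ θ₂ := fun θ₁ hθ₁ θ₂ hθ₂ =>
    sq_sub_le_pointwise ha hX τ hy hy2 hh₁ hh₁2 hh₂ hh₂2 hyN hθ₁.1 hθ₁.2 hθ₂.1 hθ₂.2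
  -- integrability of `g_j` on `[θ_a, θ_b]`
  have hint : ∀ {h : ℝ}, 1 ≤ h → h ≤ 2 * X → IntervalIntegrable (fun θ => 6 * (y / h) ^ 2 *
      (‖highPart s b τ θ (Real.log y)‖ ^ 2 + ‖highPart s b τ (θ - cShift y h) (Real.log (y + h))‖ ^ 2))
      volume (thetaA X h) (thetaB X h) := by
    intro h hh hh2
    have hh0 : (0 : ℝ) ≤ h := by linarith
    have hA0 := thetaA_nonneg hX0 hh0
    have hAB := thetaA_le_thetaB hX0 hh0
    have hc0 := cShift_nonneg hy0 hh0
    have hcA := cShift_le_thetaA hX0 hy hh0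
    refine ((intervalIntegrable_norm_sq_highPart s b τ (Real.log y) hA0 hAB le_rfl).add ?_).const_mul _
    have h2 := (intervalIntegrable_norm_sq_highPart s b τ (Real.log (y + h)) (α := thetaA X h - cShift y h)
      (β := thetaB X h - cShift y h) (Θ := thetaB X h) (by linarith) (by linarith) (by linarith)).comp_sub_right
      (cShift y h)
    simp only [sub_add_cancel] at h2
    exact h2
  have hω : ∀ {h : ℝ}, 0 < h → thetaB X h - thetaA X h = h / X := fun hh => by rw [thetaB]; ring
  -- average over θ₂, then over θ₁
  have hlt₁ : thetaA X h₁ < thetaB X h₁ := by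
    have : 0 < h₁ / X := by positivity
    rw [thetaB]; linarith
  have hlt₂ : thetaA X h₂ < thetaB X h₂ := by
    have : 0 < h₂ / X := by positivity
    rw [thetaB]; linarith
  have step1 : ∀ θ₁ ∈ Set.Icc (thetaA X h₁) (thetaB X h₁),
      LHS - A - g₁ θ₁ ≤ (h₂ / X)⁻¹ * ∫ θ in thetaA X h₂..thetaB X h₂, g₂ θ := by
    intro θ₁ hθ₁
    rw [← hω (by linarith : (0:ℝ) < h₂)]
    refine le_inv_mul_integral_of_forall_le hlt₂ (hint hh₂ hh₂2) fun θ₂ hθ₂ => ?_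
    have := hpt θ₁ hθ₁ θ₂ hθ₂; linarith
  have step2 : LHS - A - (h₂ / X)⁻¹ * ∫ θ in thetaA X h₂..thetaB X h₂, g₂ θ
      ≤ (h₁ / X)⁻¹ * ∫ θ in thetaA X h₁..thetaB X h₁, g₁ θ := by
    rw [← hω (by linarith : (0:ℝ) < h₁)]
    refine le_inv_mul_integral_of_forall_le hlt₁ (hint hh₁ hh₁2) fun θ₁ hθ₁ => ?_
    have := step1 θ₁ hθ₁; linarith
  -- evaluate the width integrals in terms of `Q`
  have hQ : ∀ {h : ℝ}, 1 ≤ h → h ≤ 2 * X →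
      (h / X)⁻¹ * ∫ θ in thetaA X h..thetaB X h, 6 * (y / h) ^ 2 *
        (‖highPart s b τ θ (Real.log y)‖ ^ 2 + ‖highPart s b τ (θ - cShift y h) (Real.log (y + h))‖ ^ 2)
      ≤ 24 * X ^ 3 / h ^ 3 * (Qint X a τ h (Real.log y) + Qint X a τ h (Real.log (y + h))) := by
    intro h hh hh2
    have hh0 : (0 : ℝ) ≤ h := by linarith
    have hA0 := thetaA_nonneg hX0 hh0
    have hAB := thetaA_le_thetaB hX0 hh0
    have i1 := intervalIntegrable_norm_sq_highPart s b τ (Real.log y) hA0 hAB le_rfl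
    have i2 : IntervalIntegrable (fun θ => ‖highPart s b τ (θ - cShift y h) (Real.log (y + h))‖ ^ 2)
        volume (thetaA X h) (thetaB X h) := by
      have h2 := (intervalIntegrable_norm_sq_highPart s b τ (Real.log (y + h)) (α := thetaA X h - cShift y h)
        (β := thetaB X h - cShift y h) (Θ := thetaB X h) (by linarith [cShift_le_thetaA hX0 hy hh0])
        (by linarith) (by linarith [cShift_nonneg hy0 hh0])).comp_sub_right (cShift y h)
      simp only [sub_add_cancel] at h2
      exact h2
    rw [intervalIntegral.integral_const_mul, intervalIntegral.integral_add i1 i2]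
    have j1 := integral_le_Qint X a τ (Real.log y) hX0 hh0
    have j2 := integral_shift_le_Qint X a τ (Real.log (y + h)) hX0 hh0 (cShift_nonneg hy0 hh0)
      (cShift_le_thetaA hX0 hy hh0)
    have hcoef : (h / X)⁻¹ * (6 * (y / h) ^ 2) ≤ 24 * X ^ 3 / h ^ 3 := by
      rw [show (h / X)⁻¹ * (6 * (y / h) ^ 2) = 6 * X * y ^ 2 / h ^ 3 by field_simp,
        div_le_div_iff_of_pos_right (by positivity)]
      nlinarith [mul_le_mul hy2 hy2 hy0.le (by linarith : (0:ℝ) ≤ 2 * X)]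
    have hQ0 : 0 ≤ Qint X a τ h (Real.log y) + Qint X a τ h (Real.log (y + h)) :=
      add_nonneg (Qint_nonneg X a τ _ hX0 hh0) (Qint_nonneg X a τ _ hX0 hh0)
    calc (h / X)⁻¹ * (6 * (y / h) ^ 2 * ((∫ θ in thetaA X h..thetaB X h, ‖highPart s b τ θ (Real.log y)‖ ^ 2)
          + ∫ θ in thetaA X h..thetaB X h, ‖highPart s b τ (θ - cShift y h) (Real.log (y + h))‖ ^ 2))
        = ((h / X)⁻¹ * (6 * (y / h) ^ 2)) * ((∫ θ in thetaA X h..thetaB X h, ‖highPart s b τ θ (Real.log y)‖ ^ 2)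
          + ∫ θ in thetaA X h..thetaB X h, ‖highPart s b τ (θ - cShift y h) (Real.log (y + h))‖ ^ 2) := by ring
      _ ≤ (24 * X ^ 3 / h ^ 3) * (Qint X a τ h (Real.log y) + Qint X a τ h (Real.log (y + h))) :=
          mul_le_mul hcoef (add_le_add j1 j2) (by
            refine add_nonneg ?_ ?_
            · exact intervalIntegral.integral_nonneg hAB fun θ _ => sq_nonneg _
            · exact intervalIntegral.integral_nonneg hAB fun θ _ => sq_nonneg _) (by positivity)
  have q1 := hQ hh₁ hh₁2
  have q2 := hQ hh₂ hh₂2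
  simp only [hg₁, hg₂] at step2
  linarith


/-! ### Integrating over `y`: change of variables `y = e^v` and Tonelli -/

/-- `exp` maps `(log A, log B]` onto `(A, B]` for `0 < A`. [folklore] -/
theorem image_exp_Ioc {A B : ℝ} (hA : 0 < A) (hB : 0 < B) :
    Real.exp '' Set.Ioc (Real.log A) (Real.log B) = Set.Ioc A B := by
  ext y
  constructor
  · rintro ⟨v, hv, rfl⟩
    exact ⟨by simpa [Real.exp_log hA] using Real.exp_lt_exp.2 hv.1,
      by simpa [Real.exp_log hB] using Real.exp_le_exp.2 hv.2⟩
  · intro hy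
    have hy0 : 0 < y := hA.trans hy.1
    refine ⟨Real.log y, ⟨Real.log_lt_log hA hy.1, Real.log_le_log hy0 hy.2⟩, Real.exp_log hy0⟩

/-- **Change of variables `y = e^v`**: for `g ≥ 0` integrable and `0 < A`, `0 < B`,
`∫_{(A,B]} g(log y) dy ≤ B ∫ g`. [folklore] -/
theorem setIntegral_comp_log_le {g : ℝ → ℝ} (hg : Integrable g) (hg0 : ∀ v, 0 ≤ g v) {A B : ℝ}
    (hA : 0 < A) (hB : 0 < B) :
    ∫ y in Set.Ioc A B, g (Real.log y) ≤ B * ∫ v, g v := by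
  have himg := image_exp_Ioc hA hB
  have hderiv : ∀ v ∈ Set.Ioc (Real.log A) (Real.log B),
      HasDerivWithinAt Real.exp (Real.exp v) (Set.Ioc (Real.log A) (Real.log B)) v :=
    fun v _ => (Real.hasDerivAt_exp v).hasDerivWithinAt
  have hcv := integral_image_eq_integral_abs_deriv_smul measurableSet_Ioc hderiv
    Real.exp_injective.injOn (fun y => g (Real.log y))
  rw [himg] at hcv
  rw [hcv]
  simp only [Real.log_exp, smul_eq_mul, abs_of_pos (Real.exp_pos _)]
  have hint : IntegrableOn (fun v => Real.exp v * g v) (Set.Ioc (Real.log A) (Real.log B)) := by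
    refine Integrable.bdd_mul (c := B) hg.integrableOn ?_ ?_
    · exact Real.continuous_exp.aestronglyMeasurable
    · refine (ae_restrict_iff' measurableSet_Ioc).2 (Eventually.of_forall fun v hv => ?_)
      rw [Real.norm_eq_abs, abs_of_pos (Real.exp_pos v)]
      calc Real.exp v ≤ Real.exp (Real.log B) := Real.exp_le_exp.2 hv.2
        _ = B := Real.exp_log hB
  calc ∫ v in Set.Ioc (Real.log A) (Real.log B), Real.exp v * g v
      ≤ ∫ v in Set.Ioc (Real.log A) (Real.log B), B * g v := by
        refine setIntegral_mono_on hint (hg.integrableOn.const_mul B) measurableSet_Ioc fun v hv => ?_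
        refine mul_le_mul_of_nonneg_right ?_ (hg0 v)
        calc Real.exp v ≤ Real.exp (Real.log B) := Real.exp_le_exp.2 hv.2
          _ = B := Real.exp_log hB
    _ = B * ∫ v in Set.Ioc (Real.log A) (Real.log B), g v := integral_const_mul _ _
    _ ≤ B * ∫ v, g v := by
        refine mul_le_mul_of_nonneg_left ?_ hB.le
        exact setIntegral_le_integral hg (Eventually.of_forall hg0)

/-- Shifted change of variables: `∫_{(A,B]} g(log(y + d)) dy ≤ (B + d) ∫ g` for `d ≥ 0`. [folklore] -/
theorem setIntegral_comp_log_add_le {g : ℝ → ℝ} (hg : Integrable g) (hg0 : ∀ v, 0 ≤ g v) {A B d : ℝ}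
    (hA : 0 < A) (hAB : A ≤ B) (hd : 0 ≤ d) :
    ∫ y in Set.Ioc A B, g (Real.log (y + d)) ≤ (B + d) * ∫ v, g v := by
  have h1 : ∫ y in Set.Ioc A B, g (Real.log (y + d)) = ∫ y in Set.Ioc (A + d) (B + d), g (Real.log y) := by
    rw [← intervalIntegral.integral_of_le hAB, ← intervalIntegral.integral_of_le (by linarith),
      intervalIntegral.integral_comp_add_right (fun y => g (Real.log y)) d]
  rw [h1]
  exact setIntegral_comp_log_le hg hg0 (by linarith) (by linarith)

/-- The high-frequency energy bound of the toolkit, in the form used here: for `θ ∈ [0, θ_b]`,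
`∫ ‖H_θ‖² ≤ P := 2 ∫_{ξ > τ'} min(θ_b², 1/(π²ξ²)) |A(ξ)|² dξ`. [folklore] -/
def Pbound (X : ℝ) (a : ℕ → ℝ) (τ h : ℝ) : ℝ :=
  2 * ∫ ξ in Set.Ioi (cutoffRadius τ), min (thetaB X h ^ 2) (1 / (π ^ 2 * ξ ^ 2))
    * ‖dirichletSum (suppM X) (coeffB a) ξ‖ ^ 2

/-- `0 ≤ P`. [folklore] -/
theorem Pbound_nonneg (X : ℝ) (a : ℕ → ℝ) (τ h : ℝ) : 0 ≤ Pbound X a τ h := by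
  unfold Pbound
  refine mul_nonneg zero_le_two (setIntegral_nonneg measurableSet_Ioi fun ξ _ => ?_)
  exact mul_nonneg (le_min (sq_nonneg _) (by positivity)) (sq_nonneg _)

/-- `∫ ‖H_θ‖² ≤ P` for `θ ∈ [0, θ_b]` (the toolkit's Plancherel bound). [folklore] -/
theorem integral_norm_sq_highPart_le_Pbound (X : ℝ) (a : ℕ → ℝ) (τ : ℝ) {h θ : ℝ}
    (hθ : 0 ≤ θ) (hθb : θ ≤ thetaB X h) :
    ∫ v, ‖highPart (suppM X) (coeffB a) τ θ v‖ ^ 2 ≤ Pbound X a τ h :=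
  integral_norm_sq_highPart_le _ _ τ hθ hθb

/-- **Tonelli step** (with a shift `d ≥ 0`): `y ↦ Q(log(y + d))` is integrable on `(A, B]` and
`∫_{(A,B]} Q(log(y + d)) dy ≤ θ_b (B + d) P` for `0 < A ≤ B`. [folklore] -/
theorem setIntegral_Qint_log_le {a : ℕ → ℝ} {X : ℝ} (hX : 1 ≤ X) (τ : ℝ) {h A B d : ℝ} (hh : 0 ≤ h)
    (hA : 0 < A) (hAB : A ≤ B) (hd : 0 ≤ d) :
    IntegrableOn (fun y => Qint X a τ h (Real.log (y + d))) (Set.Ioc A B)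
    ∧ ∫ y in Set.Ioc A B, Qint X a τ h (Real.log (y + d)) ≤ thetaB X h * (B + d) * Pbound X a τ h := by
  have hX0 : 0 < X := by linarith
  have hB : 0 < B := by linarith
  set s := suppM X
  set b := coeffB a
  set Θ := thetaB X h with hΘ
  have hΘ0 : 0 ≤ Θ := (thetaA_nonneg hX0 hh).trans (thetaA_le_thetaB hX0 hh)
  -- the integrand on the product
  set F : ℝ → ℝ → ℝ := fun y θ => ‖highPart s b τ θ (Real.log (y + d))‖ ^ 2 with hF
  have hFmeas : Measurable (Function.uncurry F) := by
    have h1 : Measurable fun p : ℝ × ℝ => (p.2, Real.log (p.1 + d)) :=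
      measurable_snd.prodMk (Real.measurable_log.comp (measurable_fst.add_const d))
    exact ((measurable_uncurry_highPart s b τ).comp h1).norm.pow_const 2
  set μ : Measure ℝ := volume.restrict (Set.Ioc A B)
  set ν : Measure ℝ := volume.restrict (Set.Ioc 0 Θ)
  haveI : IsFiniteMeasure μ := ⟨by simp [μ, Real.volume_Ioc]⟩
  haveI : IsFiniteMeasure ν := ⟨by simp [ν, Real.volume_Ioc]⟩
  set M := ((1 + 4 * cutoffRadius τ * Θ) * ∑ m ∈ s, |b m|) ^ 2
  have hFbd : ∀ y, ∀ θ ∈ Set.Ioc 0 Θ, F y θ ≤ M := fun y θ hθ =>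
    pow_le_pow_left₀ (norm_nonneg _) (norm_highPart_le s b τ hθ.1.le hθ.2 _) 2
  have hFint : Integrable (Function.uncurry F) (μ.prod ν) := by
    refine Integrable.of_bound hFmeas.aestronglyMeasurable M ?_
    have : ∀ᵐ p ∂(μ.prod ν), p.2 ∈ Set.Ioc 0 Θ :=
      (Measure.quasiMeasurePreserving_snd (μ := μ) (ν := ν)).ae (ae_restrict_mem measurableSet_Ioc)
    filter_upwards [this] with p hp
    rw [Real.norm_eq_abs, Function.uncurry, abs_of_nonneg (sq_nonneg _)]
    exact hFbd p.1 p.2 hp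
  -- `Q(log(y + d)) = ∫ F y θ dν`
  have hQ : ∀ y, Qint X a τ h (Real.log (y + d)) = ∫ θ, F y θ ∂ν := by
    intro y
    rw [Qint, intervalIntegral.integral_of_le hΘ0]
  have hQfun : (fun y => Qint X a τ h (Real.log (y + d))) = fun y => ∫ θ, F y θ ∂ν := funext hQ
  refine ⟨?_, ?_⟩
  · change Integrable (fun y => Qint X a τ h (Real.log (y + d))) μ
    rw [hQfun]
    exact hFint.integral_prod_left
  rw [hQfun]
  change ∫ y, ∫ θ, F y θ ∂ν ∂μ ≤ _
  rw [integral_integral_swap hFint]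
  -- inner bound
  have hinner : ∀ θ ∈ Set.Ioc 0 Θ, ∫ y, F y θ ∂μ ≤ (B + d) * Pbound X a τ h := by
    intro θ hθ
    have h1 := setIntegral_comp_log_add_le (g := fun v => ‖highPart s b τ θ v‖ ^ 2)
      ((memLp_two_iff_integrable_sq_norm (integrable_highPart s b τ θ).aestronglyMeasurable).1
        (memLp_two_highPart s b τ hθ.1.le)) (fun v => sq_nonneg _) hA hAB hd
    refine h1.trans (mul_le_mul_of_nonneg_left ?_ (by linarith))
    exact integral_norm_sq_highPart_le_Pbound X a τ hθ.1.le hθ.2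
  calc ∫ θ, ∫ y, F y θ ∂μ ∂ν ≤ ∫ θ, (B + d) * Pbound X a τ h ∂ν := by
        refine integral_mono_of_nonneg ?_ (integrable_const _) ?_
        · exact Eventually.of_forall fun θ => integral_nonneg fun y => sq_nonneg _
        · exact (ae_restrict_iff' measurableSet_Ioc).2 (Eventually.of_forall hinner)
    _ = thetaB X h * (B + d) * Pbound X a τ h := by
        rw [integral_const, smul_eq_mul]
        simp [ν, Measure.real, Real.volume_Ioc, ENNReal.toReal_ofReal hΘ0]
        ring

/-! ### The frequency side: from `ξ` to `t = 2πξ`, and the dyadic `max` term -/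

/-- The Dirichlet polynomial of the statement, `A(t) = ∑_{X ≤ m ≤ 4X} a_m m^{-1-it}`. [folklore] -/
def Apoly (X : ℝ) (a : ℕ → ℝ) (t : ℝ) : ℂ :=
  ∑ m ∈ suppM X, (a m : ℂ) * (m : ℂ) ^ (-(1 + (t : ℂ) * Complex.I))

/-- `A(t) = dirichletSum(t/2π)` with coefficients `b_m = a_m/m`. [folklore] -/
theorem Apoly_eq (X : ℝ) (hX : 1 ≤ X) (a : ℕ → ℝ) (t : ℝ) :
    Apoly X a t = dirichletSum (suppM X) (coeffB a) (t / (2 * π)) :=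
  sum_cpow_eq_dirichletSum a hX t

/-- `A` is continuous. [folklore] -/
theorem continuous_Apoly (X : ℝ) (hX : 1 ≤ X) (a : ℕ → ℝ) : Continuous (Apoly X a) := by
  have : Apoly X a = fun t => dirichletSum (suppM X) (coeffB a) (t / (2 * π)) :=
    funext (Apoly_eq X hX a)
  rw [this]
  exact (continuous_dirichletSum _ _).comp (continuous_id.div_const _)

/-- `|A(t)| ≤ 4`. [folklore] -/
theorem norm_Apoly_le (X : ℝ) (hX : 1 ≤ X) {a : ℕ → ℝ} (ha : ∀ m, |a m| ≤ 1) (t : ℝ) :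
    ‖Apoly X a t‖ ≤ 4 :=
  (norm_sum_cpow_le a hX t).trans (sum_abs_coeffB_le ha hX)

/-- `|A(t)|² ≤ 16`. [folklore] -/
theorem norm_sq_Apoly_le (X : ℝ) (hX : 1 ≤ X) {a : ℕ → ℝ} (ha : ∀ m, |a m| ≤ 1) (t : ℝ) :
    ‖Apoly X a t‖ ^ 2 ≤ 16 := by
  have := norm_Apoly_le X hX ha t
  nlinarith [norm_nonneg (Apoly X a t)]

/-- The `max` term of Lemma 14: `S = sup_{T ≥ U₁} (U₁/T) ∫_T^{2T} |A|²`, `U₁ = X/h₁`. [folklore] -/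
def Ssup (X : ℝ) (a : ℕ → ℝ) (U₁ : ℝ) : ℝ :=
  ⨆ T : Set.Ici U₁, U₁ / (T : ℝ) * ∫ t in (T : ℝ)..2 * T, ‖Apoly X a t‖ ^ 2

/-- The family behind the `max` term is bounded (by `16 U₁`), so the `iSup` is a genuine supremum. [folklore] -/
theorem bddAbove_Ssup (X : ℝ) (hX : 1 ≤ X) {a : ℕ → ℝ} (ha : ∀ m, |a m| ≤ 1) {U₁ : ℝ} (hU : 0 < U₁) :
    BddAbove (Set.range fun T : Set.Ici U₁ => U₁ / (T : ℝ) * ∫ t in (T : ℝ)..2 * T, ‖Apoly X a t‖ ^ 2) := by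
  refine ⟨U₁ * 16, ?_⟩
  rintro _ ⟨T, rfl⟩
  have hT : 0 < (T : ℝ) := hU.trans_le T.2
  have h1 : ∫ t in (T : ℝ)..2 * T, ‖Apoly X a t‖ ^ 2 ≤ 16 * |2 * (T : ℝ) - T| := by
    have := intervalIntegral.norm_integral_le_of_norm_le_const (a := (T : ℝ)) (b := 2 * T) (C := 16)
      (f := fun t => ‖Apoly X a t‖ ^ 2) (fun t _ => by
        rw [Real.norm_eq_abs, abs_of_nonneg (sq_nonneg _)]; exact norm_sq_Apoly_le X hX ha t)
    exact (le_abs_self _).trans (by rw [← Real.norm_eq_abs]; exact this)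
  rw [show 2 * (T : ℝ) - T = T by ring, abs_of_pos hT] at h1
  calc U₁ / (T : ℝ) * ∫ t in (T : ℝ)..2 * T, ‖Apoly X a t‖ ^ 2 ≤ U₁ / T * (16 * T) :=
        mul_le_mul_of_nonneg_left h1 (by positivity)
    _ = U₁ * 16 := by field_simp

/-- `0 ≤ S`. [folklore] -/
theorem Ssup_nonneg (X : ℝ) (a : ℕ → ℝ) {U₁ : ℝ} (hU : 0 < U₁) : 0 ≤ Ssup X a U₁ := by
  refine Real.iSup_nonneg fun T => ?_
  have hT : 0 < (T : ℝ) := hU.trans_le T.2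
  exact mul_nonneg (by positivity) (intervalIntegral.integral_nonneg (by linarith) fun t _ => sq_nonneg _)

/-- Each dyadic block is controlled by the `max` term: `∫_T^{2T} |A|² ≤ (T/U₁) S` for `T ≥ U₁`. [folklore] -/
theorem integral_le_Ssup (X : ℝ) (hX : 1 ≤ X) {a : ℕ → ℝ} (ha : ∀ m, |a m| ≤ 1) {U₁ T : ℝ}
    (hU : 0 < U₁) (hT : U₁ ≤ T) :
    ∫ t in T..2 * T, ‖Apoly X a t‖ ^ 2 ≤ T / U₁ * Ssup X a U₁ := by
  have hT0 : 0 < T := hU.trans_le hT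
  have h := le_ciSup (bddAbove_Ssup X hX ha hU) ⟨T, hT⟩
  change U₁ / T * ∫ t in T..2 * T, ‖Apoly X a t‖ ^ 2 ≤ Ssup X a U₁ at h
  rw [div_mul_eq_mul_div, div_le_iff₀ hT0] at h
  rw [div_mul_eq_mul_div, le_div_iff₀ hU]
  linarith

/-- Every `t > U₁` lies in a dyadic block `(U₁ 2^k, U₁ 2^{k+1}]`. [folklore] -/
theorem exists_mem_dyadic {U₁ t : ℝ} (hU : 0 < U₁) (ht : U₁ < t) :
    ∃ k : ℕ, t ∈ Set.Ioc (U₁ * 2 ^ k) (U₁ * 2 ^ (k + 1)) := by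
  have hex : ∃ k : ℕ, t ≤ U₁ * 2 ^ (k + 1) := by
    obtain ⟨n, hn⟩ := pow_unbounded_of_one_lt (t / U₁) (by norm_num : (1 : ℝ) < 2)
    refine ⟨n, ?_⟩
    rw [div_lt_iff₀ hU] at hn
    have : (2 : ℝ) ^ n ≤ 2 ^ (n + 1) := pow_le_pow_right₀ (by norm_num) (by omega)
    nlinarith
  classical
  refine ⟨Nat.find hex, ?_, Nat.find_spec hex⟩
  rcases (Nat.find hex).eq_zero_or_pos with h0 | hpos
  · rw [h0]; simpa using ht
  · have hmin := Nat.find_min hex (m := Nat.find hex - 1) (by omega)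
    rw [not_le, show Nat.find hex - 1 + 1 = Nat.find hex by omega] at hmin
    exact hmin

/-- The dyadic blocks cover `(U₁, ∞)`. [folklore] -/
theorem iUnion_dyadic {U₁ : ℝ} (hU : 0 < U₁) :
    (⋃ k : ℕ, Set.Ioc (U₁ * 2 ^ k) (U₁ * 2 ^ (k + 1))) = Set.Ioi U₁ := by
  ext t
  simp only [Set.mem_iUnion, Set.mem_Ioi]
  constructor
  · rintro ⟨k, hk⟩
    have : U₁ ≤ U₁ * 2 ^ k := le_mul_of_one_le_right hU.le (one_le_pow₀ (by norm_num))
    exact this.trans_lt hk.1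
  · exact fun ht => exists_mem_dyadic hU ht

/-- The dyadic blocks are pairwise disjoint. [folklore] -/
theorem pairwise_disjoint_dyadic {U₁ : ℝ} (hU : 0 < U₁) :
    Pairwise (Function.onFun Disjoint fun k : ℕ => Set.Ioc (U₁ * 2 ^ k) (U₁ * 2 ^ (k + 1))) := by
  intro i j hij
  wlog h : i < j generalizing i j
  · exact (this hij.symm (lt_of_le_of_ne (not_lt.1 h) hij.symm)).symm
  refine Set.disjoint_left.2 fun t hti htj => ?_
  have h1 : U₁ * 2 ^ (i + 1) ≤ U₁ * 2 ^ j :=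
    mul_le_mul_of_nonneg_left (pow_le_pow_right₀ (by norm_num) (by omega)) hU.le
  linarith [hti.2, htj.1]

/-- `t ↦ |A(t)|²/t²` is integrable on `(U, ∞)` for `U ≥ 1`. [folklore] -/
theorem integrableOn_norm_sq_Apoly_div (X : ℝ) (hX : 1 ≤ X) {a : ℕ → ℝ} (ha : ∀ m, |a m| ≤ 1)
    {U : ℝ} (hU : 1 ≤ U) : IntegrableOn (fun t => ‖Apoly X a t‖ ^ 2 / t ^ 2) (Set.Ioi U) := by
  have hmeas : AEStronglyMeasurable (fun t => ‖Apoly X a t‖ ^ 2 / t ^ 2) (volume.restrict (Set.Ioi U)) := by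
    refine (Measurable.div ((continuous_Apoly X hX a).norm.measurable.pow_const 2)
      (measurable_id.pow_const 2)).aestronglyMeasurable
  refine ((integrable_inv_one_add_sq.const_mul 32).integrableOn).mono' hmeas ?_
  refine (ae_restrict_iff' measurableSet_Ioi).2 (Eventually.of_forall fun t ht => ?_)
  have ht1 : 1 ≤ t := hU.trans ht.le
  rw [Real.norm_eq_abs, abs_of_nonneg (by positivity), ← div_eq_mul_inv]
  have hA := norm_sq_Apoly_le X hX ha t
  calc ‖Apoly X a t‖ ^ 2 / t ^ 2 ≤ 16 / t ^ 2 := div_le_div_of_nonneg_right hA (by positivity)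
    _ ≤ 32 / (1 + t ^ 2) := by
        rw [div_le_div_iff₀ (by positivity) (by positivity)]
        nlinarith

/-- **The dyadic bound**: `∫_{U₁}^∞ |A|²/t² ≤ 2 S / U₁²`. [cite: MatomakiRadziwillAnnals2016, §7, proof of Lemma 14 (last display)] -/
theorem integral_Ioi_le_Ssup (X : ℝ) (hX : 1 ≤ X) {a : ℕ → ℝ} (ha : ∀ m, |a m| ≤ 1) {U₁ : ℝ}
    (hU : 1 ≤ U₁) :
    ∫ t in Set.Ioi U₁, ‖Apoly X a t‖ ^ 2 / t ^ 2 ≤ 2 * Ssup X a U₁ / U₁ ^ 2 := by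
  have hU0 : 0 < U₁ := by linarith
  set f : ℝ → ℝ := fun t => ‖Apoly X a t‖ ^ 2 / t ^ 2
  set blk : ℕ → Set ℝ := fun k => Set.Ioc (U₁ * 2 ^ k) (U₁ * 2 ^ (k + 1))
  have hint : IntegrableOn f (⋃ k, blk k) := by
    rw [iUnion_dyadic hU0]; exact integrableOn_norm_sq_Apoly_div X hX ha hU
  have hsum := hasSum_integral_iUnion (f := f) (μ := volume) (fun k => measurableSet_Ioc)
    (pairwise_disjoint_dyadic hU0) hint
  rw [iUnion_dyadic hU0] at hsum
  -- bound for each block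
  have hblk : ∀ k : ℕ, ∫ t in blk k, f t ≤ Ssup X a U₁ / U₁ ^ 2 * (1 / 2) ^ k := by
    intro k
    set T := U₁ * 2 ^ k with hT
    have hT0 : 0 < T := by positivity
    have hUT : U₁ ≤ T := le_mul_of_one_le_right hU0.le (one_le_pow₀ (by norm_num))
    have hcont : Continuous fun t => ‖Apoly X a t‖ ^ 2 := ((continuous_Apoly X hX a).norm).pow 2
    have h2T : U₁ * 2 ^ (k + 1) = 2 * T := by rw [hT, pow_succ]; ring
    have step1 : ∫ t in blk k, f t ≤ ∫ t in blk k, T⁻¹ ^ 2 * ‖Apoly X a t‖ ^ 2 := by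
      refine setIntegral_mono_on (hint.mono_set (Set.subset_iUnion blk k)) ?_ measurableSet_Ioc ?_
      · exact (hcont.const_mul _ |>.integrableOn_Icc).mono_set Set.Ioc_subset_Icc_self
      · intro t ht
        have ht0 : T < t := ht.1
        simp only [f]
        rw [div_eq_mul_inv, mul_comm]
        refine mul_le_mul_of_nonneg_right ?_ (sq_nonneg _)
        rw [← inv_pow]
        have ht0' : 0 < t := hT0.trans ht0
        exact pow_le_pow_left₀ (inv_pos.2 ht0').le ((inv_le_inv₀ ht0' hT0).2 ht0.le) 2
    have step2 : ∫ t in blk k, T⁻¹ ^ 2 * ‖Apoly X a t‖ ^ 2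
        = T⁻¹ ^ 2 * ∫ t in T..2 * T, ‖Apoly X a t‖ ^ 2 := by
      rw [integral_const_mul, intervalIntegral.integral_of_le (by linarith)]
      simp only [blk, h2T, hT]
    have step3 := integral_le_Ssup X hX ha hU0 hUT
    calc ∫ t in blk k, f t ≤ T⁻¹ ^ 2 * ∫ t in T..2 * T, ‖Apoly X a t‖ ^ 2 := step1.trans step2.le
      _ ≤ T⁻¹ ^ 2 * (T / U₁ * Ssup X a U₁) := mul_le_mul_of_nonneg_left step3 (by positivity)
      _ = Ssup X a U₁ / U₁ ^ 2 * (1 / 2) ^ k := by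
          rw [hT, one_div_pow]; field_simp
  have hgeo : HasSum (fun k : ℕ => Ssup X a U₁ / U₁ ^ 2 * (1 / 2 : ℝ) ^ k) (Ssup X a U₁ / U₁ ^ 2 * 2) :=
    hasSum_geometric_two.mul_left _
  have := hasSum_le hblk hsum hgeo
  calc ∫ t in Set.Ioi U₁, f t ≤ Ssup X a U₁ / U₁ ^ 2 * 2 := this
    _ = 2 * Ssup X a U₁ / U₁ ^ 2 := by ring

/-- **Splitting the frequency integral** at `U = X/h`: for `T₀ ≤ T'`, `T₀ ≤ U ≤ U₁`, `1 ≤ U`,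
`∫_{t > T'} min(Θ², 4/t²) |A|² ≤ Θ² I₁ + 4 (I₁/U² + 2S/U₁²)` with `I₁ = ∫_{T₀}^{U₁} |A|²`.
[cite: MatomakiRadziwillAnnals2016, §7, proof of Lemma 14] -/
theorem integral_Ioi_min_le (X : ℝ) (hX : 1 ≤ X) {a : ℕ → ℝ} (ha : ∀ m, |a m| ≤ 1)
    {T₀ T' U U₁ Θ : ℝ} (hT₀ : 0 < T₀) (hT' : T₀ ≤ T') (hU : T₀ ≤ U) (hU1 : 1 ≤ U) (hUU : U ≤ U₁) :
    ∫ t in Set.Ioi T', min (Θ ^ 2) (4 / t ^ 2) * ‖Apoly X a t‖ ^ 2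
      ≤ Θ ^ 2 * (∫ t in T₀..U₁, ‖Apoly X a t‖ ^ 2)
        + 4 * ((∫ t in T₀..U₁, ‖Apoly X a t‖ ^ 2) / U ^ 2 + 2 * Ssup X a U₁ / U₁ ^ 2) := by
  have hU0 : 0 < U := by linarith
  have hU₁1 : 1 ≤ U₁ := hU1.trans hUU
  set A2 : ℝ → ℝ := fun t => ‖Apoly X a t‖ ^ 2 with hA2
  have hcont : Continuous A2 := ((continuous_Apoly X hX a).norm).pow 2
  have hA2nn : ∀ t, 0 ≤ A2 t := fun t => sq_nonneg _
  set I₁ := ∫ t in T₀..U₁, A2 t with hI₁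
  have hI₁' : I₁ = ∫ t in Set.Ioc T₀ U₁, A2 t := intervalIntegral.integral_of_le (hU.trans hUU)
  have hI₁0 : 0 ≤ I₁ := intervalIntegral.integral_nonneg (hU.trans hUU) fun t _ => hA2nn t
  -- the two majorants
  set g₁ : ℝ → ℝ := (Set.Ioc T₀ U₁).indicator fun t => Θ ^ 2 * A2 t
  set g₂ : ℝ → ℝ := (Set.Ioi U).indicator fun t => 4 * (A2 t / t ^ 2)
  have hg₁int : Integrable g₁ := by
    refine (integrable_indicator_iff measurableSet_Ioc).2 ?_
    exact ((hcont.const_mul _).integrableOn_Icc).mono_set Set.Ioc_subset_Icc_self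
  have hJint := integrableOn_norm_sq_Apoly_div X hX ha hU1
  have hg₂int : Integrable g₂ := by
    refine (integrable_indicator_iff measurableSet_Ioi).2 ?_
    exact hJint.const_mul 4
  have hpt : ∀ t ∈ Set.Ioi T', min (Θ ^ 2) (4 / t ^ 2) * A2 t ≤ g₁ t + g₂ t := by
    intro t ht
    have htT₀ : T₀ < t := hT'.trans_lt ht
    rcases le_or_gt t U with htU | htU
    · have h1 : g₁ t = Θ ^ 2 * A2 t :=
        Set.indicator_of_mem (show t ∈ Set.Ioc T₀ U₁ from ⟨htT₀, htU.trans hUU⟩) _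
      have h2 : 0 ≤ g₂ t := Set.indicator_nonneg (fun t _ => by positivity) t
      calc min (Θ ^ 2) (4 / t ^ 2) * A2 t ≤ Θ ^ 2 * A2 t :=
            mul_le_mul_of_nonneg_right (min_le_left _ _) (hA2nn t)
        _ ≤ g₁ t + g₂ t := by linarith
    · have h2 : g₂ t = 4 * (A2 t / t ^ 2) := Set.indicator_of_mem (Set.mem_Ioi.2 htU) _
      have h1 : 0 ≤ g₁ t := Set.indicator_nonneg (fun t _ => by positivity) t
      calc min (Θ ^ 2) (4 / t ^ 2) * A2 t ≤ 4 / t ^ 2 * A2 t :=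
            mul_le_mul_of_nonneg_right (min_le_right _ _) (hA2nn t)
        _ = 4 * (A2 t / t ^ 2) := by ring
        _ ≤ g₁ t + g₂ t := by linarith
  -- integrate
  have hmeas : AEStronglyMeasurable (fun t => min (Θ ^ 2) (4 / t ^ 2) * A2 t) (volume.restrict (Set.Ioi T')) := by
    refine Measurable.aestronglyMeasurable ?_
    exact (measurable_const.min (measurable_const.div (measurable_id.pow_const 2))).mul hcont.measurable
  have hLint : IntegrableOn (fun t => min (Θ ^ 2) (4 / t ^ 2) * A2 t) (Set.Ioi T') := by
    refine Integrable.mono' ((hg₁int.add hg₂int).integrableOn) hmeas ?_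
    refine (ae_restrict_iff' measurableSet_Ioi).2 (Eventually.of_forall fun t ht => ?_)
    rw [Real.norm_eq_abs, abs_of_nonneg (mul_nonneg (le_min (sq_nonneg _) (by positivity)) (hA2nn t))]
    exact hpt t ht
  calc ∫ t in Set.Ioi T', min (Θ ^ 2) (4 / t ^ 2) * A2 t
      ≤ ∫ t in Set.Ioi T', (g₁ t + g₂ t) :=
        setIntegral_mono_on hLint (hg₁int.add hg₂int).integrableOn measurableSet_Ioi hpt
    _ ≤ ∫ t, (g₁ t + g₂ t) := by
        refine setIntegral_le_integral (hg₁int.add hg₂int) (Eventually.of_forall fun t => ?_)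
        exact add_nonneg (Set.indicator_nonneg (fun t _ => by positivity) t)
          (Set.indicator_nonneg (fun t _ => by positivity) t)
    _ = (∫ t, g₁ t) + ∫ t, g₂ t := integral_add hg₁int hg₂int
    _ = Θ ^ 2 * I₁ + 4 * ∫ t in Set.Ioi U, A2 t / t ^ 2 := by
        simp only [g₁, g₂]
        rw [integral_indicator measurableSet_Ioc, integral_indicator measurableSet_Ioi,
          integral_const_mul, integral_const_mul, hI₁']
    _ ≤ Θ ^ 2 * I₁ + 4 * (I₁ / U ^ 2 + 2 * Ssup X a U₁ / U₁ ^ 2) := by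
        gcongr
        -- split `(U, ∞) = (U, U₁] ∪ (U₁, ∞)`
        have hsplit : Set.Ioi U = Set.Ioc U U₁ ∪ Set.Ioi U₁ := (Set.Ioc_union_Ioi_eq_Ioi hUU).symm
        rw [hsplit, setIntegral_union (Set.Ioc_disjoint_Ioi le_rfl) measurableSet_Ioi
          (hJint.mono_set (by rw [hsplit]; exact Set.subset_union_left))
          (hJint.mono_set (by rw [hsplit]; exact Set.subset_union_right))]
        refine add_le_add ?_ (integral_Ioi_le_Ssup X hX ha hU₁1)
        calc ∫ t in Set.Ioc U U₁, A2 t / t ^ 2 ≤ ∫ t in Set.Ioc U U₁, A2 t / U ^ 2 := by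
              refine setIntegral_mono_on (hJint.mono_set (by rw [hsplit]; exact Set.subset_union_left))
                ((hcont.div_const _).integrableOn_Icc.mono_set Set.Ioc_subset_Icc_self)
                measurableSet_Ioc fun t ht => ?_
              exact div_le_div_of_nonneg_left (hA2nn t) (by positivity)
                (pow_le_pow_left₀ hU0.le ht.1.le 2)
          _ = (∫ t in Set.Ioc U U₁, A2 t) / U ^ 2 := by
              simp_rw [div_eq_mul_inv]; exact integral_mul_const _ _
          _ ≤ I₁ / U ^ 2 := by
              refine div_le_div_of_nonneg_right ?_ (by positivity)
              rw [hI₁']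
              exact setIntegral_mono_set (hcont.integrableOn_Icc.mono_set Set.Ioc_subset_Icc_self)
                (Eventually.of_forall hA2nn) (Set.Ioc_subset_Ioc_left hU).eventuallyLE


/-! ### The energy bound `P` in terms of `I₁` and `S` -/

/-- `P = π⁻¹ ∫_{t > 2πτ'} min(θ_b², 4/t²) |A(t)|² dt` (the substitution `t = 2πξ`). [folklore] -/
theorem Pbound_eq (X : ℝ) (hX : 1 ≤ X) (a : ℕ → ℝ) (τ h : ℝ) :
    Pbound X a τ h = π⁻¹ * ∫ t in Set.Ioi (2 * π * cutoffRadius τ),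
      min (thetaB X h ^ 2) (4 / t ^ 2) * ‖Apoly X a t‖ ^ 2 := by
  set G : ℝ → ℝ := fun t => min (thetaB X h ^ 2) (4 / t ^ 2) * ‖Apoly X a t‖ ^ 2 with hG
  have h2π : (0 : ℝ) < 2 * π := by positivity
  have hsub := MeasureTheory.integral_comp_mul_left_Ioi G (cutoffRadius τ) h2π
  have hG' : ∀ ξ : ℝ, G (2 * π * ξ) = min (thetaB X h ^ 2) (1 / (π ^ 2 * ξ ^ 2))
      * ‖dirichletSum (suppM X) (coeffB a) ξ‖ ^ 2 := by
    intro ξ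
    simp only [hG, Apoly_eq X hX]
    rw [show 2 * π * ξ / (2 * π) = ξ by field_simp]
    rcases eq_or_ne ξ 0 with hξ | hξ
    · simp [hξ]
    · congr 2
      field_simp
      ring
  simp_rw [hG'] at hsub
  rw [Pbound, hsub, smul_eq_mul]
  field_simp

/-- **`P ≤ (8/π)(h/X)² (I₁ + S)`** for `h₁ ≤ h ≤ X/T₀`, `T₀ = (log X)^{1/15} ≤ 2πτ'`. [cite: MatomakiRadziwillAnnals2016, §7, proof of Lemma 14] -/
theorem Pbound_le (X : ℝ) (hX : 1 ≤ X) {a : ℕ → ℝ} (ha : ∀ m, |a m| ≤ 1) {τ h h₁ T₀ : ℝ}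
    (hT₀ : 1 ≤ T₀) (hT₀τ : T₀ ≤ 2 * π * cutoffRadius τ) (hh₁ : 1 ≤ h₁) (hh : h₁ ≤ h)
    (hhU : T₀ ≤ X / h) :
    Pbound X a τ h ≤ 8 / π * (h / X) ^ 2 *
      ((∫ t in T₀..X / h₁, ‖Apoly X a t‖ ^ 2) + Ssup X a (X / h₁)) := by
  have hX0 : 0 < X := by linarith
  have hh0 : 0 < h := by linarith
  have hU1 : 1 ≤ X / h := hT₀.trans hhU
  have hUU : X / h ≤ X / h₁ := div_le_div_of_nonneg_left hX0.le (by linarith) hh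
  have hU₁0 : 0 < X / h₁ := by positivity
  set I₁ := ∫ t in T₀..X / h₁, ‖Apoly X a t‖ ^ 2 with hI₁
  set S := Ssup X a (X / h₁)
  have hI₁0 : 0 ≤ I₁ := intervalIntegral.integral_nonneg (hhU.trans hUU) fun t _ => sq_nonneg _
  have hS0 : 0 ≤ S := Ssup_nonneg X a hU₁0
  have h1 := integral_Ioi_min_le X hX ha (Θ := thetaB X h) (by linarith) hT₀τ hhU hU1 hUU
  rw [Pbound_eq X hX]
  have hθb : thetaB X h ^ 2 ≤ 4 * (h / X) ^ 2 := by
    have h0 : 0 ≤ thetaB X h := (thetaA_nonneg hX0 hh0.le).trans (thetaA_le_thetaB hX0 hh0.le)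
    have := thetaB_le hX0 hh0.le
    nlinarith
  have hU2 : 1 / (X / h) ^ 2 = (h / X) ^ 2 := by field_simp
  have hU₁2 : 1 / (X / h₁) ^ 2 ≤ (h / X) ^ 2 := by
    rw [← hU2]; exact one_div_le_one_div_of_le (by positivity) (pow_le_pow_left₀ (by positivity) hUU 2)
  have hπ : 0 < π⁻¹ := inv_pos.2 Real.pi_pos
  calc π⁻¹ * ∫ t in Set.Ioi (2 * π * cutoffRadius τ), min (thetaB X h ^ 2) (4 / t ^ 2) * ‖Apoly X a t‖ ^ 2
      ≤ π⁻¹ * (thetaB X h ^ 2 * I₁ + 4 * (I₁ / (X / h) ^ 2 + 2 * S / (X / h₁) ^ 2)) :=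
        mul_le_mul_of_nonneg_left h1 hπ.le
    _ ≤ π⁻¹ * (4 * (h / X) ^ 2 * I₁ + 4 * ((h / X) ^ 2 * I₁ + 2 * ((h / X) ^ 2 * S))) := by
        refine mul_le_mul_of_nonneg_left ?_ hπ.le
        have e1 : I₁ / (X / h) ^ 2 = (h / X) ^ 2 * I₁ := by rw [div_eq_mul_one_div, hU2, mul_comm]
        have e2 : 2 * S / (X / h₁) ^ 2 ≤ 2 * ((h / X) ^ 2 * S) := by
          rw [div_eq_mul_one_div]
          calc 2 * S * (1 / (X / h₁) ^ 2) ≤ 2 * S * (h / X) ^ 2 :=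
                mul_le_mul_of_nonneg_left hU₁2 (by positivity)
            _ = 2 * ((h / X) ^ 2 * S) := by ring
        rw [e1]
        nlinarith [mul_le_mul_of_nonneg_right hθb hI₁0]
    _ = 8 / π * (h / X) ^ 2 * (I₁ + S) := by ring


/-! ### Integrating the pointwise bound over `y ∈ (X, 2X]` -/

/-- Lebesgue-almost every real number is not a natural number. [folklore] -/
theorem ae_not_natCast : ∀ᵐ y : ℝ, ∀ n : ℕ, (n : ℝ) ≠ y := by
  have h0 : volume (Set.range (Nat.cast : ℕ → ℝ)) = 0 :=
    (Set.countable_range _).measure_zero volume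
  filter_upwards [measure_eq_zero_iff_ae_notMem.1 h0] with y hy n hn
  exact hy ⟨n, hn⟩

/-- **The mean square over `(X, 2X]`** in terms of the width-averaged energies:
`∫_{(X,2X]} (D₁ - D₂)² ≤ 3 (K(h₁+h₂)/X)² X + ∑_j (24X³/h_j³) θ_b(h_j) (4X + h_j) P_j`.
[cite: MatomakiRadziwillAnnals2016, §7, proof of Lemma 14] -/
theorem setIntegral_sq_sub_le {a : ℕ → ℝ} (ha : ∀ m, |a m| ≤ 1) {X : ℝ} (hX : 1 ≤ X) (τ : ℝ)
    {h₁ h₂ : ℝ} (hh₁ : 1 ≤ h₁) (hh₁2 : h₁ ≤ 2 * X) (hh₂ : 1 ≤ h₂) (hh₂2 : h₂ ≤ 2 * X) :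
    ∫ y in Set.Ioc X (2 * X),
        (h₁⁻¹ * ∑ m ∈ Finset.Icc ⌈y⌉₊ ⌊y + h₁⌋₊, a m - h₂⁻¹ * ∑ m ∈ Finset.Icc ⌈y⌉₊ ⌊y + h₂⌋₊, a m) ^ 2
      ≤ 3 * (Kconst τ * ((h₁ + h₂) / X)) ^ 2 * X
        + 24 * X ^ 3 / h₁ ^ 3 * (thetaB X h₁ * (4 * X + h₁) * Pbound X a τ h₁)
        + 24 * X ^ 3 / h₂ ^ 3 * (thetaB X h₂ * (4 * X + h₂) * Pbound X a τ h₂) := by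
  have hX0 : 0 < X := by linarith
  have hX2 : X ≤ 2 * X := by linarith
  set μ : Measure ℝ := volume.restrict (Set.Ioc X (2 * X))
  haveI : IsFiniteMeasure μ := ⟨by simp [μ, Real.volume_Ioc]⟩
  set A := 3 * (Kconst τ * ((h₁ + h₂) / X)) ^ 2
  set c₁ := 24 * X ^ 3 / h₁ ^ 3
  set c₂ := 24 * X ^ 3 / h₂ ^ 3
  set Q₁ : ℝ → ℝ := fun y => Qint X a τ h₁ (Real.log (y + 0)) + Qint X a τ h₁ (Real.log (y + h₁))
  set Q₂ : ℝ → ℝ := fun y => Qint X a τ h₂ (Real.log (y + 0)) + Qint X a τ h₂ (Real.log (y + h₂))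
  set R : ℝ → ℝ := fun y => A + c₁ * Q₁ y + c₂ * Q₂ y with hR
  -- integrability and integral bounds of the `Q` pieces
  obtain ⟨i10, b10⟩ := setIntegral_Qint_log_le (a := a) hX τ (h := h₁) (by linarith) hX0 hX2 le_rfl
  obtain ⟨i11, b11⟩ := setIntegral_Qint_log_le (a := a) hX τ (h := h₁) (by linarith) hX0 hX2 (by linarith : (0:ℝ) ≤ h₁)
  obtain ⟨i20, b20⟩ := setIntegral_Qint_log_le (a := a) hX τ (h := h₂) (by linarith) hX0 hX2 le_rfl
  obtain ⟨i21, b21⟩ := setIntegral_Qint_log_le (a := a) hX τ (h := h₂) (by linarith) hX0 hX2 (by linarith : (0:ℝ) ≤ h₂)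
  have iQ₁ : Integrable Q₁ μ := i10.add i11
  have iQ₂ : Integrable Q₂ μ := i20.add i21
  have iR : Integrable R μ := ((integrable_const A).add (iQ₁.const_mul c₁)).add (iQ₂.const_mul c₂)
  -- the pointwise bound, almost everywhere on `(X, 2X]`
  have hae : ∀ᵐ y ∂μ, (h₁⁻¹ * ∑ m ∈ Finset.Icc ⌈y⌉₊ ⌊y + h₁⌋₊, a m
      - h₂⁻¹ * ∑ m ∈ Finset.Icc ⌈y⌉₊ ⌊y + h₂⌋₊, a m) ^ 2 ≤ R y := by
    have h1 : ∀ᵐ y ∂μ, y ∈ Set.Ioc X (2 * X) := ae_restrict_mem measurableSet_Ioc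
    have h2 : ∀ᵐ y ∂μ, ∀ n : ℕ, (n : ℝ) ≠ y := ae_restrict_of_ae ae_not_natCast
    filter_upwards [h1, h2] with y hy hyN
    have := sq_sub_le_Qint ha hX τ hy.1.le hy.2 hh₁ hh₁2 hh₂ hh₂2 hyN
    simp only [hR, Q₁, Q₂, add_zero]
    linarith
  calc ∫ y in Set.Ioc X (2 * X), (h₁⁻¹ * ∑ m ∈ Finset.Icc ⌈y⌉₊ ⌊y + h₁⌋₊, a m
        - h₂⁻¹ * ∑ m ∈ Finset.Icc ⌈y⌉₊ ⌊y + h₂⌋₊, a m) ^ 2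
      ≤ ∫ y, R y ∂μ := integral_mono_of_nonneg (Eventually.of_forall fun y => sq_nonneg _) iR hae
    _ = A * X + c₁ * ((∫ y, Qint X a τ h₁ (Real.log (y + 0)) ∂μ) + ∫ y, Qint X a τ h₁ (Real.log (y + h₁)) ∂μ)
        + c₂ * ((∫ y, Qint X a τ h₂ (Real.log (y + 0)) ∂μ) + ∫ y, Qint X a τ h₂ (Real.log (y + h₂)) ∂μ) := by
        have e1 : ∫ y, R y ∂μ = (∫ y, (A + c₁ * Q₁ y) ∂μ) + ∫ y, c₂ * Q₂ y ∂μ :=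
          integral_add ((integrable_const A).add (iQ₁.const_mul c₁)) (iQ₂.const_mul c₂)
        have e2 : ∫ y, (A + c₁ * Q₁ y) ∂μ = (∫ y, A ∂μ) + ∫ y, c₁ * Q₁ y ∂μ :=
          integral_add (integrable_const A) (iQ₁.const_mul c₁)
        have e3 : ∫ y, Q₁ y ∂μ = (∫ y, Qint X a τ h₁ (Real.log (y + 0)) ∂μ)
            + ∫ y, Qint X a τ h₁ (Real.log (y + h₁)) ∂μ := integral_add i10 i11
        have e4 : ∫ y, Q₂ y ∂μ = (∫ y, Qint X a τ h₂ (Real.log (y + 0)) ∂μ)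
            + ∫ y, Qint X a τ h₂ (Real.log (y + h₂)) ∂μ := integral_add i20 i21
        have eA : ∫ y, A ∂μ = A * X := by
          rw [integral_const, smul_eq_mul]
          simp only [μ, Measure.real, Measure.restrict_apply MeasurableSet.univ, Set.univ_inter,
            Real.volume_Ioc]
          rw [show 2 * X - X = X by ring, ENNReal.toReal_ofReal hX0.le]
          ring
        have ec₁ : ∫ y, c₁ * Q₁ y ∂μ = c₁ * ∫ y, Q₁ y ∂μ := integral_const_mul _ _
        have ec₂ : ∫ y, c₂ * Q₂ y ∂μ = c₂ * ∫ y, Q₂ y ∂μ := integral_const_mul _ _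
        rw [e1, e2, eA, ec₁, ec₂, e3, e4]
    _ ≤ A * X + c₁ * (thetaB X h₁ * (2 * X + 0) * Pbound X a τ h₁ + thetaB X h₁ * (2 * X + h₁) * Pbound X a τ h₁)
        + c₂ * (thetaB X h₂ * (2 * X + 0) * Pbound X a τ h₂ + thetaB X h₂ * (2 * X + h₂) * Pbound X a τ h₂) := by
        gcongr
    _ = _ := by ring


/-! ### Assembly -/

/-- The `j`-th energy term is `≤ 640 X (I₁ + S)`:
`(24X³/h³) θ_b (4X + h) P ≤ (24X³/h³)(2h/X)(5X)(8/π)(h/X)²(I₁+S) ≤ 640 X (I₁+S)` (using `π > 3`). [folklore] -/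
theorem energy_term_le {X h I S P θb : ℝ} (hX : 0 < X) (hh : 0 < h) (hhX : h ≤ X)
    (hθb : θb ≤ 2 * (h / X)) (hIS : 0 ≤ I + S) (hP0 : 0 ≤ P) (hP : P ≤ 8 / π * (h / X) ^ 2 * (I + S)) :
    24 * X ^ 3 / h ^ 3 * (θb * (4 * X + h) * P) ≤ 640 * X * (I + S) := by
  have hπ : 8 / π ≤ 8 / 3 := div_le_div_of_nonneg_left (by norm_num) (by norm_num) Real.pi_gt_three.le
  have h1 : θb * (4 * X + h) * P ≤ (2 * (h / X)) * (5 * X) * (8 / 3 * (h / X) ^ 2 * (I + S)) := by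
    refine mul_le_mul (mul_le_mul hθb (by linarith) (by positivity) (by positivity)) ?_ hP0 (by positivity)
    exact hP.trans (mul_le_mul_of_nonneg_right (mul_le_mul_of_nonneg_right hπ (sq_nonneg _)) hIS)
  calc 24 * X ^ 3 / h ^ 3 * (θb * (4 * X + h) * P)
      ≤ 24 * X ^ 3 / h ^ 3 * ((2 * (h / X)) * (5 * X) * (8 / 3 * (h / X) ^ 2 * (I + S))) :=
        mul_le_mul_of_nonneg_left h1 (by positivity)
    _ = 640 * X * (I + S) := by field_simp; ring

end MatomakiRadziwillL14

open MatomakiRadziwillL14 in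
/-- **Matomäki–Radziwiłł 2016, Lemma 14 (Parseval bound), proved** in its faithful real-sequence
rendering `MatomakiRadziwill2016_lemma14_real`, with `C = 12 · 2431²` and `X₀ = e`.

Proof (files `DirichletPolynomialShortWindows.lean` and this one): in the variable `v = log x` the
additive window `(y, y+h]` is written, for every multiplicative width `θ ∈ [θ_a, θ_b]`
(`θ_a = log(1+h/X)`, `θ_b = θ_a + h/X`), as the difference of the multiplicative windows `(y, ye^θ]`
and `(y+h, ye^θ]` (`addWindow_eq_sub`); each multiplicative window sum `W_θ` splits as `L_θ + H_θ`
by a smooth frequency cutoff at `|t| ≍ T₀ = (log X)^{1/15}`.  The low parts give `Ψ(log y)`,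
independent of `h`, up to `O(τ'² h/X)` (`norm_avg_sub_main_sub_high_le`), so they cancel between
`h₁` and `h₂` up to `O(T₀² h₂/X) = O((log X)^{-1/15})`; the high parts are averaged over `θ`
(`sq_sub_le_Qint`), integrated over `y` by Tonelli and the change of variables `y = e^v`
(`setIntegral_Qint_log_le`), and bounded by Plancherel (`integral_norm_sq_highPart_le`) in terms of
`∫_{t>2πτ'} min(θ_b², 4/t²)|A(t)|² dt`, which is at most `(8/π)(h/X)²(I₁ + S)` (`Pbound_le`: the range
`t ≤ X/h` gives `I₁ = ∫_{T₀}^{X/h₁}|A|²`, the range `t > X/h₁` is cut dyadically against the `max` term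
`S`, `integral_Ioi_le_Ssup`).  The symmetry `|A(-t)| = |A(t)|` of real sequences enters through
`integral_norm_sq_highPart_le`. [cite: MatomakiRadziwillAnnals2016, Lemma 14] -/
theorem MatomakiRadziwill2016_lemma14_real_holds : MatomakiRadziwill2016_lemma14_real := by
  refine ⟨12 * 2431 ^ 2, Real.exp 1, ?_⟩
  intro a ha X h₁ hX hh₁ hh₁₂
  -- sizes
  have hXe : Real.exp 1 ≤ X := hX
  have hX1 : 1 ≤ X := le_trans (by have := Real.add_one_le_exp (1 : ℝ); linarith) hXe
  have hX0 : 0 < X := by linarith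
  set ℓ := Real.log X with hℓ
  have hℓ1 : 1 ≤ ℓ := by
    rw [hℓ, ← Real.log_exp 1]; exact Real.log_le_log (Real.exp_pos 1) hXe
  have hℓ0 : 0 < ℓ := by linarith
  set T₀ := ℓ ^ (1 / 15 : ℝ) with hT₀
  have hT₀1 : 1 ≤ T₀ := Real.one_le_rpow hℓ1 (by norm_num)
  have hℓ5 : 1 ≤ ℓ ^ (1 / 5 : ℝ) := Real.one_le_rpow hℓ1 (by norm_num)
  have hℓ5pos : 0 < ℓ ^ (1 / 5 : ℝ) := by linarith
  set h₂ := X / ℓ ^ (1 / 5 : ℝ) with hh₂def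
  have hh₂X : h₂ ≤ X := div_le_self hX0.le hℓ5
  have hh₂1 : 1 ≤ h₂ := hh₁.trans hh₁₂
  have hU₂ : X / h₂ = ℓ ^ (1 / 5 : ℝ) := by
    rw [hh₂def]; field_simp
  have hT₀U₂ : T₀ ≤ X / h₂ := by
    rw [hU₂]; exact Real.rpow_le_rpow_of_exponent_le hℓ1 (by norm_num)
  have hT₀U₁ : T₀ ≤ X / h₁ := hT₀U₂.trans (div_le_div_of_nonneg_left hX0.le (by linarith) hh₁₂)
  set τ := T₀ / (2 * π) with hτ
  have h2π : (0 : ℝ) < 2 * π := by positivity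
  have hT₀τ : T₀ ≤ 2 * π * cutoffRadius τ := by
    have : τ ≤ cutoffRadius τ := le_max_left _ _
    calc T₀ = 2 * π * τ := by rw [hτ]; field_simp
      _ ≤ 2 * π * cutoffRadius τ := mul_le_mul_of_nonneg_left this h2π.le
  have hrad : cutoffRadius τ ≤ T₀ := by
    refine max_le ?_ hT₀1
    rw [hτ, div_le_iff₀ h2π]
    nlinarith [Real.pi_gt_three]
  -- the `y`-integral and the energy bounds
  have hmain := MatomakiRadziwillL14.setIntegral_sq_sub_le ha hX1 τ hh₁ (by linarith) hh₂1 (by linarith)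
  have hP₁ := MatomakiRadziwillL14.Pbound_le X hX1 ha (τ := τ) (h := h₁) hT₀1 hT₀τ hh₁ le_rfl hT₀U₁
  have hP₂ := MatomakiRadziwillL14.Pbound_le X hX1 ha (τ := τ) (h := h₂) hT₀1 hT₀τ hh₁ hh₁₂ hT₀U₂
  set I₁ := ∫ t in T₀..X / h₁, ‖MatomakiRadziwillL14.Apoly X a t‖ ^ 2 with hI₁
  set S := MatomakiRadziwillL14.Ssup X a (X / h₁) with hS
  have hI₁0 : 0 ≤ I₁ := intervalIntegral.integral_nonneg hT₀U₁ fun t _ => sq_nonneg _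
  have hS0 : 0 ≤ S := MatomakiRadziwillL14.Ssup_nonneg X a (by positivity)
  have hE₁ := MatomakiRadziwillL14.energy_term_le (I := I₁) (S := S) hX0 (by linarith) (hh₁₂.trans hh₂X)
    (MatomakiRadziwillL14.thetaB_le hX0 (by linarith)) (add_nonneg hI₁0 hS0) (MatomakiRadziwillL14.Pbound_nonneg X a τ h₁) hP₁
  have hE₂ := MatomakiRadziwillL14.energy_term_le (I := I₁) (S := S) hX0 (by linarith) hh₂X
    (MatomakiRadziwillL14.thetaB_le hX0 (by linarith)) (add_nonneg hI₁0 hS0) (MatomakiRadziwillL14.Pbound_nonneg X a τ h₂) hP₂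
  -- the first (`U`-part) term: `3 (K(h₁+h₂)/X)² X ≤ 12·2431² X / ℓ^{2/15}`
  have hK := MatomakiRadziwillL14.Kconst_le τ
  have hK0 := (MatomakiRadziwillL14.Kconst_pos τ).le
  have hrad0 := (cutoffRadius_pos τ).le
  have hpow : T₀ ^ 4 * h₂ ^ 2 / X = X / ℓ ^ (2 / 15 : ℝ) := by
    have e1 : T₀ ^ 4 = ℓ ^ (4 / 15 : ℝ) := by
      rw [hT₀, ← Real.rpow_natCast, ← Real.rpow_mul hℓ0.le]; norm_num
    have e2 : (ℓ ^ (1 / 5 : ℝ)) ^ 2 = ℓ ^ (2 / 5 : ℝ) := by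
      rw [← Real.rpow_natCast, ← Real.rpow_mul hℓ0.le]; norm_num
    have e3 : ℓ ^ (4 / 15 : ℝ) = ℓ ^ (2 / 5 : ℝ) / ℓ ^ (2 / 15 : ℝ) := by
      rw [eq_div_iff (Real.rpow_pos_of_pos hℓ0 _).ne', ← Real.rpow_add hℓ0]; norm_num
    rw [e1, hh₂def, div_pow, e2, e3]
    field_simp
  have hfirst : 3 * (MatomakiRadziwillL14.Kconst τ * ((h₁ + h₂) / X)) ^ 2 * X ≤ 12 * 2431 ^ 2 * (X / ℓ ^ (2 / 15 : ℝ)) := by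
    have h1 : MatomakiRadziwillL14.Kconst τ ≤ 2431 * T₀ ^ 2 :=
      hK.trans (mul_le_mul_of_nonneg_left (pow_le_pow_left₀ hrad0 hrad 2) (by norm_num))
    have h2 : (h₁ + h₂) / X ≤ 2 * h₂ / X := div_le_div_of_nonneg_right (by linarith) hX0.le
    have h3 : MatomakiRadziwillL14.Kconst τ * ((h₁ + h₂) / X) ≤ 2431 * T₀ ^ 2 * (2 * h₂ / X) :=
      mul_le_mul h1 h2 (by positivity) (by positivity)
    calc 3 * (MatomakiRadziwillL14.Kconst τ * ((h₁ + h₂) / X)) ^ 2 * X ≤ 3 * (2431 * T₀ ^ 2 * (2 * h₂ / X)) ^ 2 * X := by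
          gcongr
      _ = 12 * 2431 ^ 2 * (T₀ ^ 4 * h₂ ^ 2 / X) := by field_simp; ring
      _ = 12 * 2431 ^ 2 * (X / ℓ ^ (2 / 15 : ℝ)) := by rw [hpow]
  -- assemble
  rw [intervalIntegral.integral_of_le (by linarith : X ≤ 2 * X)]
  change X⁻¹ * ∫ x in Set.Ioc X (2 * X), (h₁⁻¹ * ∑ m ∈ Finset.Icc ⌈x⌉₊ ⌊x + h₁⌋₊, a m
      - h₂⁻¹ * ∑ m ∈ Finset.Icc ⌈x⌉₊ ⌊x + h₂⌋₊, a m) ^ 2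
    ≤ 12 * 2431 ^ 2 * (1 / ℓ ^ (2 / 15 : ℝ) + I₁ + S)
  have htot : ∫ x in Set.Ioc X (2 * X), (h₁⁻¹ * ∑ m ∈ Finset.Icc ⌈x⌉₊ ⌊x + h₁⌋₊, a m
      - h₂⁻¹ * ∑ m ∈ Finset.Icc ⌈x⌉₊ ⌊x + h₂⌋₊, a m) ^ 2
      ≤ 12 * 2431 ^ 2 * (X / ℓ ^ (2 / 15 : ℝ)) + 1280 * X * (I₁ + S) := by
    linarith
  rw [← div_eq_inv_mul, div_le_iff₀ hX0]
  have hIS : 1280 * X * (I₁ + S) ≤ 12 * 2431 ^ 2 * X * (I₁ + S) :=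
    mul_le_mul_of_nonneg_right (mul_le_mul_of_nonneg_right (by norm_num) hX0.le) (add_nonneg hI₁0 hS0)
  calc ∫ x in Set.Ioc X (2 * X), (h₁⁻¹ * ∑ m ∈ Finset.Icc ⌈x⌉₊ ⌊x + h₁⌋₊, a m
        - h₂⁻¹ * ∑ m ∈ Finset.Icc ⌈x⌉₊ ⌊x + h₂⌋₊, a m) ^ 2
      ≤ 12 * 2431 ^ 2 * (X / ℓ ^ (2 / 15 : ℝ)) + 12 * 2431 ^ 2 * X * (I₁ + S) := htot.trans (by linarith)
    _ = 12 * 2431 ^ 2 * (1 / ℓ ^ (2 / 15 : ℝ) + I₁ + S) * X := by ring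

end Literature.NumberTheory.Sieve
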